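import Mathlib
import Literature.NumberTheory.LFunctions.Zhang2022.Section18RangeEdges
import Literature.NumberTheory.LFunctions.Zhang2022.Section18Ded183
import Literature.NumberTheory.LFunctions.Zhang2022.TypedSection10Rel
import Literature.NumberTheory.LFunctions.Zhang2022.SkeletonAlpha1
import Literature.NumberTheory.LFunctions.Zhang2022.SkeletonLemma102RelW
import HarnessLib

/-!
# Zhang (2022) §18, proof of (2.33): the range evaluations of `S_j(𝐚₂₃,𝐚₂₃)` and the cone
# `Eq183 → Prop71 → Lemma101 → (Lemma 10.2, RELATIVE) → Bound183` from the RELATIVE Lemma 10.2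

Topic `Literature/NumberTheory/LFunctions/Zhang2022` (Landau–Siegel audit tree; verdict-neutral).
Y. Zhang, *Discrete mean estimates and the Landau–Siegel zero*, arXiv:2211.02515v1 (2022)
[Zhang2022LandauSiegel], §18 p.100 (tex L4928–L4955) — **an unrefereed manuscript under adjudication**.
Lane ZHANG-L, re-type RT-01′ of the §10 binder (zl-lead START-HERE R-06/R-13): the printed Lemma 10.2
(`Skeleton.Lemma102`, uniform errors `C𝓛⁻¹⁵`, `C𝓛⁻⁷`) is derivable only in a RELATIVE form — clauses
(10.8)–(10.10) with the error `C𝓛⁻¹⁵·(∏_{q∣dr}(1−q⁻¹)⁻¹)² = C𝓛⁻¹⁵·(dr/φ(dr))²` (GAP row G-d43-1) and the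
window clause (10.11) with a bound of the shape `C·𝓛^{−18/5}·(dr/φ(dr))²` (GAP row G-d60-1; the three
candidate readings `C𝓛⁻⁷·(dr/φ(dr))²`, `C(1+‖Π(d,r)‖)𝓛⁻⁷` and `C𝓛(1+𝓛^{1.1})⁴𝓛⁻⁹·(dr/φ(dr))²` all imply
it for `𝓛 ≥ 1`). This theorem-only companion of `Section18RangeEdges` / `Section18Range1` (same §18
engine, 0 new definitions, 0 named facts) re-runs the §18 cone over such a relative Lemma 10.2, with
every Lemma-10.2 input stated as a POINTWISE hypothesis at fixed `D` (engine) or as the two inline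
clause bundles (assembly):

* engine (fixed `D`): `perN_main_rel`, `perN_window_rel` — the per-`n` estimates of `Section18RangeEdges`
  with the relative errors, the extra factor `(n/φ(n))²` absorbed by raising the mass exponent `5 → 9`;
  `mass_bulk_le9` (`≤ 2e^{1024}𝓛⁹`) and the SHARP window mass `mass_window_le9` (`≤ e^{1024}(2 + 𝓛^{1.1})`,
  the window `(P^c/T, P^c]` having log-length `log T = 𝓛^{1.1}` — NOT rounded to `𝓛²`: with the window
  rate `𝓛^{−18/5}` the budget is `𝓛^{1.1}·𝓛⁻⁷·𝓛^{−3.6} = 𝓛^{−9.5} = o(α)`, `α = π𝓛⁻⁹`, margin `𝓛^{−1/2}`);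
  `range_estimate_rel` — a main range `[P^a, P^b)` from pointwise inputs; `range1_bound_at_rel` — the first
  range `dr < P^{1/2}` (sz-d56's `range1_bound_at` with the relative clauses; weight `∏(1+106/q)` on the
  window as on the tiny range);
* assembly: `step18_u010_of_rel`, `step18_u011b_of_rel`, `step18_range1_of_rel` — the three range
  evaluations `Typed.Section18.Step18_u010 / Step18_u011b / Step18_range1` from `Skeleton.Lemma101` and the
  two relative Lemma-10.2 clause bundles (stated inline, verbatim the clause texts of
  `Skeleton.Lemma102Rel` (1–3) and the window shape above); `bound183_of_rel` — `Skeleton.Bound183 c′`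
  from `Eq183`, `Prop71`, `Lemma101` and the two bundles (through `Sec18Ded183.bound183_of_steps`,
  `step18_u014_of_u013`, `Section18SjEdges.step18_u013_of_ranges` / `sjNorm_of_ranges`,
  `ecal23Negligible_of_sjNorm`, and the outright nodes `step18_u008/u009/u012_holds`).

The binder decl of record for RT-01′ (`Lemma102RelW` / `Ded183RelW`, zl-w10-typer) is instantiated from
`bound183_of_rel` by projecting its clauses (one-line corollary, filed when that statement file lands).
**Every proposition named `Step18_…`, `Lemma10k`, `Eq183`, `Prop71`, `Bound183` is a CLAIM of an unrefereed
manuscript under adjudication; this file proves implications between claims from kernel theorems of the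
tree.** Nothing here bears on Theorems 1–2 of the source or on Landau–Siegel zeros.

## References

* Y. Zhang, arXiv:2211.02515v1 (2022), §18 p.100 (tex L4928–L4955); §10 Lemmas 10.1–10.2
  ((10.2)–(10.5), (10.8)–(10.11)) pp.53–55; §8 (8.10) p.48; §2 (2.10). [cite: Zhang2022LandauSiegel, §18 p.100]
* R. R. Hall, G. Tenenbaum, *Divisors*, CUP 1988, §0.2 (the sub-multiplicative majorants behind
  `Skeleton.sum_ratio_pow_div_le`). [cite: HallTenenbaum1988, §0.2]
-/

noncomputable section

open Complex Real Finset

namespace Literature.NumberTheory.LFunctions.Zhang2022.Typed.Section18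

open Skeleton

variable (c' : ℝ)

/-! ### Thresholds and small facts (private copies of `Section18RangeEdges`'s) -/

section Thresholds

/-- For every `K` there is `D₁` with `K ≤ 𝓛 = log D` for all `D ≥ D₁`. [folklore] -/
private theorem exists_ell_ge' (K : ℝ) : ∃ D₁ : ℕ, ∀ D : ℕ, D₁ ≤ D → K ≤ ell D := by
  refine ⟨⌈Real.exp K⌉₊ + 1, fun D hD => ?_⟩
  have hD1 : Real.exp K ≤ D := by
    have := Nat.ceil_le.mp (show ⌈Real.exp K⌉₊ ≤ D by omega)
    exact_mod_cast this
  rw [ell, ← Real.log_exp K]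
  exact Real.log_le_log (Real.exp_pos _) hD1

variable {D : ℕ}

/-- `α = π/log P = π𝓛⁻⁹` (2.10). [folklore] -/
private theorem alpha_eq' (D : ℕ) : alpha D = π / ell D ^ 9 := by
  rw [alpha, bigP, Real.log_exp]

/-- `1 ≤ P^a` for `a ≥ 0`. [folklore] -/
private theorem one_le_Ppow'' (D : ℕ) {a : ℝ} (ha : 0 ≤ a) : 1 ≤ bigP D ^ a := by
  rw [bigP]; exact Real.one_le_rpow (Real.one_le_exp (pow_nonneg (ell_nonneg (D := D)) 9)) ha

/-- `C₁(𝓛ᵐ)⁻¹ ≤ C/𝓛ᵐ` for `C₁ ≤ C`. [folklore] -/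
private theorem mul_inv_le_div' {C₁ C L : ℝ} (m : ℕ) (h : C₁ ≤ C) (hL : 0 ≤ L) :
    C₁ * (L ^ m)⁻¹ ≤ C / L ^ m := by
  rw [div_eq_mul_inv]
  exact mul_le_mul_of_nonneg_right h (inv_nonneg.mpr (pow_nonneg hL m))

/-- The relative factor squared is `(n/φ(n))²`: `(∏_{q∣n}(1 − q⁻¹)⁻¹)² = (n/φ(n))²` (`n ≠ 0`; Euler's
product `n/φ(n) = ∏_{q∣n} q/(q−1)`, tree `Skeleton.self_div_totient_eq_prod`).
[cite: Zhang2022LandauSiegel, §8 Lemma 8.4] -/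
private theorem prod_one_sub_inv_inv_sq_eq' {n : ℕ} (hn : n ≠ 0) :
    (∏ q ∈ n.primeFactors, (1 - (q : ℝ)⁻¹)⁻¹) ^ 2 = ((n : ℝ) / Nat.totient n) ^ 2 := by
  rw [self_div_totient_eq_prod hn]
  congr 1
  refine Finset.prod_congr rfl fun q hq => ?_
  have h2 : (2 : ℝ) ≤ q := by exact_mod_cast (Nat.prime_of_mem_primeFactors hq).two_le
  have hq0 : (q : ℝ) ≠ 0 := by linarith
  have hq1 : (q : ℝ) - 1 ≠ 0 := by linarith
  field_simp

/-- `1 ≤ (n/φ(n))²` for `n ≠ 0`. [folklore] -/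
private theorem one_le_ratio_sq {n : ℕ} (hn : n ≠ 0) : 1 ≤ ((n : ℝ) / Nat.totient n) ^ 2 :=
  one_le_pow₀ (one_le_self_div_totient hn)

end Thresholds

/-! ### The engine, relative form: the estimates at one `n` -/

section EngineRel

variable {D : ℕ} (χ : DirichletCharacter ℂ D)

/-- **The estimate at one `n` of a main range, relative errors** (the bookkeeping of "by the discussion
in Section 8 and 10", p.100, over the RELATIVE Lemma 10.2): if `𝔳₁ⱼ(n) = pA + O(δ)` and
`𝔳₂ⱼ(n/r, r) = pΠ(n/r, r)B + O(δ·(n/φ(n))²)` for every squarefree `r ∣ n`, then the divisor sum at `n`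
equals the main summand `p²|χ(n)|λ₀ⱼ(n)/φ(n)·AB` up to `(n/φ(n))⁹n⁻¹·δ(K_p(K_A+K_B) + δ)`
(`Section18RangeEdges.perN_main` at `δ(n/φ(n))²`, `(n/φ(n))² ≤ (n/φ(n))⁴`).
[cite: Zhang2022LandauSiegel, §18 p.100; §8 (8.10)] -/
theorem perN_main_rel [NeZero D] (hq : χ.IsQuadratic) (j : ℕ) {n : ℕ} (hn : 1 ≤ n) {p A B : ℂ}
    {δ KA KB Kp : ℝ} (hδ : 0 ≤ δ) (hKp : 0 ≤ Kp) (hA : ‖A‖ ≤ KA) (hB : ‖B‖ ≤ KB) (hp : ‖p‖ ≤ Kp)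
    (h1 : ‖frakv1 c' χ j (n : ℝ) - p * A‖ ≤ δ)
    (h2 : ∀ r ∈ n.divisors, Squarefree r →
      ‖frakv2 c' χ j (n / r) r - p * PiW χ (n / r) r * B‖ ≤ δ * ((n : ℝ) / Nat.totient n) ^ 2) :
    ‖((‖χ (n : ZMod D)‖ : ℝ) : ℂ) * lamZero c' D j n / (n : ℂ) * frakv1 c' χ j (n : ℝ) *
          (∑ r ∈ n.divisors with Squarefree r, frakv2 c' χ j (n / r) r / (Nat.totient r : ℂ)) -
        p ^ 2 * (((‖χ (n : ZMod D)‖ : ℝ) : ℂ) * lamZero c' D j n / (Nat.totient n : ℂ) * A * B)‖ ≤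
      ((n : ℝ) / Nat.totient n) ^ 9 / n * (δ * (Kp * (KA + KB) + δ)) := by
  have hn0 : n ≠ 0 := by omega
  set ρ2 : ℝ := ((n : ℝ) / Nat.totient n) ^ 2 with hρ2
  have hρ1 : 1 ≤ ρ2 := one_le_ratio_sq hn0
  have hρ0 : 0 ≤ (n : ℝ) / Nat.totient n := le_trans zero_le_one (one_le_self_div_totient hn0)
  have hKA : 0 ≤ KA := le_trans (norm_nonneg _) hA
  have hKB : 0 ≤ KB := le_trans (norm_nonneg _) hB
  have hδ' : 0 ≤ δ * ρ2 := by positivity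
  have h1' : ‖frakv1 c' χ j (n : ℝ) - p * A‖ ≤ δ * ρ2 :=
    h1.trans (le_mul_of_one_le_right hδ hρ1)
  have h := perN_main c' χ hq j hn hδ' hKp hA hB hp h1' h2
  refine h.trans ?_
  have hn' : (0 : ℝ) < n := by exact_mod_cast hn
  have key : δ * ρ2 * (Kp * (KA + KB) + δ * ρ2) ≤ ρ2 * ρ2 * (δ * (Kp * (KA + KB) + δ)) := by
    have : δ * ρ2 * (Kp * (KA + KB)) ≤ δ * ρ2 * (Kp * (KA + KB)) * ρ2 :=
      le_mul_of_one_le_right (by positivity) hρ1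
    nlinarith
  calc ((n : ℝ) / Nat.totient n) ^ 5 / n * (δ * ρ2 * (Kp * (KA + KB) + δ * ρ2))
      ≤ ((n : ℝ) / Nat.totient n) ^ 5 / n * (ρ2 * ρ2 * (δ * (Kp * (KA + KB) + δ))) :=
        mul_le_mul_of_nonneg_left key (by positivity)
    _ = ((n : ℝ) / Nat.totient n) ^ 9 / n * (δ * (Kp * (KA + KB) + δ)) := by
        rw [hρ2]; ring

/-- **The estimate at one `n` of an edge window, relative window rate**: if `|𝔳₁ⱼ(n)| ≤ δ₁` and
`|𝔳₂ⱼ(n/r, r)| ≤ δ₂·(n/φ(n))²` for every squarefree `r ∣ n`, the divisor sum at `n` is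
`≤ (n/φ(n))⁹n⁻¹·δ₁δ₂` in norm. [cite: Zhang2022LandauSiegel, §18 p.100; §10 (10.5), (10.11)] -/
theorem perN_window_rel (j : ℕ) {n : ℕ} (hn : 1 ≤ n) {δ₁ δ₂ : ℝ} (hδ₁ : 0 ≤ δ₁) (hδ₂ : 0 ≤ δ₂)
    (h1 : ‖frakv1 c' χ j (n : ℝ)‖ ≤ δ₁)
    (h2 : ∀ r ∈ n.divisors, Squarefree r →
      ‖frakv2 c' χ j (n / r) r‖ ≤ δ₂ * ((n : ℝ) / Nat.totient n) ^ 2) :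
    ‖((‖χ (n : ZMod D)‖ : ℝ) : ℂ) * lamZero c' D j n / (n : ℂ) * frakv1 c' χ j (n : ℝ) *
        (∑ r ∈ n.divisors with Squarefree r, frakv2 c' χ j (n / r) r / (Nat.totient r : ℂ))‖ ≤
      ((n : ℝ) / Nat.totient n) ^ 9 / n * (δ₁ * δ₂) := by
  have hn0 : n ≠ 0 := by omega
  set ρ2 : ℝ := ((n : ℝ) / Nat.totient n) ^ 2 with hρ2
  have hρ1 : 1 ≤ ρ2 := one_le_ratio_sq hn0
  have hρ0 : 0 ≤ (n : ℝ) / Nat.totient n := le_trans zero_le_one (one_le_self_div_totient hn0)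
  have h := perN_window c' χ j hn hδ₁ h1 h2
  refine h.trans ?_
  have hn' : (0 : ℝ) < n := by exact_mod_cast hn
  have key : δ₁ * (δ₂ * ρ2) ≤ ρ2 * ρ2 * (δ₁ * δ₂) := by
    have : δ₁ * δ₂ * ρ2 ≤ δ₁ * δ₂ * ρ2 * ρ2 := le_mul_of_one_le_right (by positivity) hρ1
    nlinarith
  calc ((n : ℝ) / Nat.totient n) ^ 5 / n * (δ₁ * (δ₂ * ρ2))
      ≤ ((n : ℝ) / Nat.totient n) ^ 5 / n * (ρ2 * ρ2 * (δ₁ * δ₂)) :=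
        mul_le_mul_of_nonneg_left key (by positivity)
    _ = ((n : ℝ) / Nat.totient n) ^ 9 / n * (δ₁ * δ₂) := by rw [hρ2]; ring

/-- The size of the main summand with the exponent `9`: `‖p²|χ(n)|λ₀ⱼ(n)/φ(n)·AB‖ ≤ (n/φ(n))⁹n⁻¹·K_p²K_AK_B`
(`Section18RangeEdges.perN_mainTerm_le`, `(n/φ(n))⁵ ≤ (n/φ(n))⁹`). [cite: Zhang2022LandauSiegel, §18 p.100] -/
theorem perN_mainTerm_le9 (j : ℕ) {n : ℕ} (hn : 1 ≤ n) {p A B : ℂ} {KA KB Kp : ℝ}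
    (hA : ‖A‖ ≤ KA) (hB : ‖B‖ ≤ KB) (hp : ‖p‖ ≤ Kp) :
    ‖p ^ 2 * (((‖χ (n : ZMod D)‖ : ℝ) : ℂ) * lamZero c' D j n / (Nat.totient n : ℂ) * A * B)‖ ≤
      ((n : ℝ) / Nat.totient n) ^ 9 / n * (Kp ^ 2 * KA * KB) := by
  have hn0 : n ≠ 0 := by omega
  have hKA : 0 ≤ KA := le_trans (norm_nonneg _) hA
  have hKB : 0 ≤ KB := le_trans (norm_nonneg _) hB
  have hρ1 : 1 ≤ (n : ℝ) / Nat.totient n := one_le_self_div_totient hn0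
  have hn' : (0 : ℝ) < n := by exact_mod_cast hn
  refine (perN_mainTerm_le c' χ j hn hA hB hp).trans ?_
  have h59 : ((n : ℝ) / Nat.totient n) ^ 5 ≤ ((n : ℝ) / Nat.totient n) ^ 9 :=
    pow_le_pow_right₀ hρ1 (by norm_num)
  exact mul_le_mul_of_nonneg_right (div_le_div_of_nonneg_right h59 hn'.le) (by positivity)

/-! ### The masses with the exponent `9`: bulk `≤ 2e^{1024}𝓛⁹`, window `≤ e^{1024}(2 + 𝓛^{1.1})` (sharp) -/

omit χ in
/-- `Σ_{n ≤ ⌈PT⁻²⌉, n ≥ 2} (n/φ(n))⁹/n ≤ 2e^{1024}𝓛⁹` (`Skeleton.sum_ratio_pow_div_le 9`, `1 + log⌈PT⁻²⌉ ≤ 2𝓛⁹`).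
[cite: Zhang2022LandauSiegel, §18 p.100; §7 (7.2)] -/
theorem mass_bulk_le9 (hL : 2 ≤ ell D) {S : Finset ℕ} (hS : ∀ n ∈ S, 2 ≤ n ∧ n ≤ Nsupp D) :
    ∑ n ∈ S, ((n : ℝ) / Nat.totient n) ^ 9 / n ≤ 2 * Real.exp 1024 * ell D ^ 9 := by
  have hsub : S ⊆ Ioc 1 (Nsupp D) := fun n hn => by
    have := hS n hn; rw [mem_Ioc]; omega
  have hN : 1 ≤ Nsupp D := Nat.one_le_iff_ne_zero.mpr (Nat.pos_iff_ne_zero.mp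
    (Nat.ceil_pos.mpr (div_pos (Real.exp_pos _) (pow_pos (Real.exp_pos _) 2))))
  have hW := Skeleton.sum_ratio_pow_div_le 9 one_pos hN
  rw [Nat.cast_one, Real.log_one, sub_zero] at hW
  have h64 : Real.exp (2 ^ (9 + 1)) = Real.exp 1024 := by norm_num
  rw [h64] at hW
  have hlogN := Sec18SjNorm.one_add_log_Nsupp_le hL
  calc ∑ n ∈ S, ((n : ℝ) / Nat.totient n) ^ 9 / n
      ≤ ∑ n ∈ Ioc 1 (Nsupp D), ((n : ℝ) / Nat.totient n) ^ 9 / n :=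
        Finset.sum_le_sum_of_subset_of_nonneg hsub fun n _ _ => by positivity
    _ ≤ Real.exp 1024 * (1 + Real.log (Nsupp D)) := hW
    _ ≤ Real.exp 1024 * (2 * ell D ^ 9) := mul_le_mul_of_nonneg_left hlogN (Real.exp_pos _).le
    _ = 2 * Real.exp 1024 * ell D ^ 9 := by ring

omit χ in
/-- The edge windows `(P^c/T, P^c]` (`c ≥ 0.5`) are SHORT: `Σ_{P^c/T < n ≤ P^c} (n/φ(n))⁹/n ≤
e^{1024}(1 + log 2 + log T) ≤ e^{1024}(2 + 𝓛^{1.1})` (`log T = 𝓛^{1.1}`, `𝓛 ≥ 2`; the log-length is kept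
at `𝓛^{1.1}`, which the relative window rate needs). [cite: Zhang2022LandauSiegel, §10 (10.5), (10.11); §18 p.100] -/
theorem mass_window_le9 (hL : 2 ≤ ell D) {c : ℝ} (hc : 0.5 ≤ c) {S : Finset ℕ}
    (hS : ∀ n ∈ S, bigP D ^ c / bigT D < n ∧ (n : ℝ) ≤ bigP D ^ c) :
    ∑ n ∈ S, ((n : ℝ) / Nat.totient n) ^ 9 / n ≤ Real.exp 1024 * (2 + ell D ^ (1.1 : ℝ)) := by
  have hL1 : 1 ≤ ell D := by linarith
  set Q : ℝ := bigP D ^ c with hQ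
  have hQpos : 0 < Q := Real.rpow_pos_of_pos (Real.exp_pos _) _
  have hT1 : 1 ≤ bigT D := by rw [bigT]; exact Real.one_le_exp (Real.rpow_nonneg (ell_nonneg D) _)
  have hTpos : 0 < bigT D := lt_of_lt_of_le one_pos hT1
  have hlogT : Real.log (bigT D) = ell D ^ (1.1 : ℝ) := by rw [bigT, Real.log_exp]
  have hlogQ : Real.log Q = c * ell D ^ 9 := by
    rw [hQ, Real.log_rpow (show 0 < bigP D from Real.exp_pos _), bigP, Real.log_exp]
  have h11 : ell D ^ (1.1 : ℝ) ≤ ell D ^ 2 := by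
    have := Real.rpow_le_rpow_of_exponent_le hL1 (show (1.1 : ℝ) ≤ 2 by norm_num)
    rwa [Real.rpow_two] at this
  have h11pos : 0 ≤ ell D ^ (1.1 : ℝ) := Real.rpow_nonneg (by linarith) _
  have h2 : (4 : ℝ) ≤ ell D ^ 2 := by nlinarith
  -- `Q/T ≥ 2`
  have hQT : 2 ≤ Q / bigT D := by
    have hexp : Q / bigT D = Real.exp (c * ell D ^ 9 - ell D ^ (1.1 : ℝ)) := by
      rw [Real.exp_sub, hQ, bigP, ← Real.exp_mul, bigT]; ring_nf
    rw [hexp]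
    have h7 : (2 : ℝ) ^ 7 ≤ ell D ^ 7 := pow_le_pow_left₀ (by norm_num) hL 7
    have hc7 : (64 : ℝ) ≤ c * ell D ^ 7 := by nlinarith [h7, hc]
    have hA : 64 * ell D ^ 2 ≤ c * ell D ^ 9 := by
      have : c * ell D ^ 9 = c * ell D ^ 7 * ell D ^ 2 := by ring
      rw [this]
      exact mul_le_mul_of_nonneg_right hc7 (by positivity)
    have hge : (1 : ℝ) ≤ c * ell D ^ 9 - ell D ^ (1.1 : ℝ) := by nlinarith [h11, hA, h2]
    calc (2 : ℝ) ≤ Real.exp 1 := by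
          have := Real.add_one_le_exp (1 : ℝ); linarith
      _ ≤ Real.exp (c * ell D ^ 9 - ell D ^ (1.1 : ℝ)) := Real.exp_le_exp.mpr hge
  by_cases hSe : S = ∅
  · rw [hSe, Finset.sum_empty]; positivity
  obtain ⟨n₀, hn₀⟩ := Finset.nonempty_iff_ne_empty.mpr hSe
  set Y : ℕ := ⌊Q / bigT D⌋₊ with hY
  set X : ℕ := ⌊Q⌋₊ with hX
  have hYpos : 0 < Y := Nat.floor_pos.mpr (by linarith)
  have hsub : S ⊆ Ioc Y X := fun n hn => by
    obtain ⟨h1, h2⟩ := hS n hn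
    rw [mem_Ioc]
    refine ⟨?_, Nat.le_floor h2⟩
    have : (Y : ℝ) < n := lt_of_le_of_lt (Nat.floor_le (by positivity)) h1
    exact_mod_cast this
  have hYX : Y ≤ X := by
    have := hsub hn₀; rw [mem_Ioc] at this; omega
  have hW := Skeleton.sum_ratio_pow_div_le 9 hYpos hYX
  have h64 : Real.exp (2 ^ (9 + 1)) = Real.exp 1024 := by norm_num
  rw [h64] at hW
  -- `1 + log X − log Y ≤ 2 + 𝓛^{1.1}`
  have hXpos : (0 : ℝ) < X := by
    have := hsub hn₀; rw [mem_Ioc] at this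
    exact_mod_cast (show 0 < X by omega)
  have hlogX : Real.log X ≤ Real.log Q :=
    Real.log_le_log hXpos (Nat.floor_le hQpos.le)
  have hYge : Q / (2 * bigT D) ≤ Y := by
    have hfl : Q / bigT D - 1 ≤ (Y : ℝ) := by
      have := Nat.lt_floor_add_one (Q / bigT D); rw [← hY] at this; linarith
    have : Q / (2 * bigT D) = Q / bigT D - Q / bigT D / 2 := by field_simp; ring
    rw [this]; linarith
  have hlogY : Real.log Q - Real.log 2 - Real.log (bigT D) ≤ Real.log Y := by
    have h := Real.log_le_log (by positivity) hYge
    rw [Real.log_div hQpos.ne' (by positivity), Real.log_mul (by norm_num) hTpos.ne'] at h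
    linarith
  have hlog2 : Real.log 2 ≤ 1 := by
    have := Real.log_two_lt_d9; linarith
  calc ∑ n ∈ S, ((n : ℝ) / Nat.totient n) ^ 9 / n
      ≤ ∑ n ∈ Ioc Y X, ((n : ℝ) / Nat.totient n) ^ 9 / n :=
        Finset.sum_le_sum_of_subset_of_nonneg hsub fun n _ _ => by positivity
    _ ≤ Real.exp 1024 * (1 + Real.log X - Real.log Y) := hW
    _ ≤ Real.exp 1024 * (2 + ell D ^ (1.1 : ℝ)) := by
        refine mul_le_mul_of_nonneg_left ?_ (Real.exp_pos _).le
        rw [hlogT] at hlogY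
        linarith


/-! ### The engine, relative form: a main range `[P^a, P^b)` from its pointwise inputs -/

/-- **The range evaluation from pointwise inputs, relative Lemma 10.2** (the implicit bookkeeping of
"by the discussion in Section 8 and 10", p.100): on a range `[P^a, P^b)` (`0.5 ≤ a ≤ b ≤ 0.504`), if
`𝔳₁ⱼ(n) = pA(n) + O(C𝓛⁻¹⁵)` and `𝔳₂ⱼ(d,r) = pΠ(d,r)B(dr) + O(C𝓛⁻¹⁵(dr/φ(dr))²)` on the bulk
`P^a < n ≤ P^b/T`, `𝔳₁ⱼ = O(C𝓛⁻⁷)` and `𝔳₂ⱼ(d,r) = O(C_w𝓛^{−18/5}(dr/φ(dr))²)` on the edge windows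
`(P^a/T, P^a]`, `(P^b/T, P^b)`, then `Sj23Range(P^a, P^b) = p²Σ_{P^a ≤ n < P^b}|χ(n)|λ₀ⱼ(n)/φ(n)A(n)B(n)` up
to the displayed explicit error (bulk mass `2e^{1024}𝓛⁹`, window masses `e^{1024}(2 + 𝓛^{1.1})`).
[cite: Zhang2022LandauSiegel, §18 p.100; §10 Lemmas 10.1–10.2] -/
theorem range_estimate_rel [NeZero D] (hq : χ.IsQuadratic) (hL : 2 ≤ ell D) (j : ℕ) {a b : ℝ}
    (ha : 0.5 ≤ a) (hab : a ≤ b) (hb : b ≤ 0.504) (A B : ℕ → ℂ) (p : ℂ)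
    {C Cw KA KB Kp : ℝ} (hC : 0 ≤ C) (hCw : 0 ≤ Cw) (hKA : 0 ≤ KA) (hKB : 0 ≤ KB) (hKp : 0 ≤ Kp)
    (hp : ‖p‖ ≤ Kp)
    (hAB : ∀ n : ℕ, bigP D ^ a ≤ n → (n : ℝ) < bigP D ^ b → ‖A n‖ ≤ KA ∧ ‖B n‖ ≤ KB)
    (h1m : ∀ n : ℕ, bigP D ^ a < n → (n : ℝ) ≤ bigP D ^ b / bigT D →
      ‖frakv1 c' χ j n - p * A n‖ ≤ C / ell D ^ 15)
    (h2m : ∀ n : ℕ, bigP D ^ a < n → (n : ℝ) ≤ bigP D ^ b / bigT D →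
      ∀ r ∈ n.divisors, Squarefree r →
        ‖frakv2 c' χ j (n / r) r - p * PiW χ (n / r) r * B n‖ ≤
          C / ell D ^ 15 * ((n : ℝ) / Nat.totient n) ^ 2)
    (h1w : ∀ n : ℕ, (bigP D ^ a / bigT D < n ∧ (n : ℝ) ≤ bigP D ^ a) ∨
        (bigP D ^ b / bigT D < n ∧ (n : ℝ) < bigP D ^ b) → ‖frakv1 c' χ j n‖ ≤ C / ell D ^ 7)
    (h2w : ∀ n : ℕ, (bigP D ^ a / bigT D < n ∧ (n : ℝ) ≤ bigP D ^ a) ∨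
        (bigP D ^ b / bigT D < n ∧ (n : ℝ) < bigP D ^ b) →
      ∀ r ∈ n.divisors, Squarefree r →
        ‖frakv2 c' χ j (n / r) r‖ ≤ Cw / ell D ^ (18 / 5 : ℝ) * ((n : ℝ) / Nat.totient n) ^ 2) :
    ‖Sj23Range c' χ j (bigP D ^ a) (bigP D ^ b) -
        p ^ 2 * ∑ n ∈ (Ico 1 (Nsupp D)).filter
            (fun n : ℕ => bigP D ^ a ≤ (n : ℝ) ∧ (n : ℝ) < bigP D ^ b),
          ((‖χ (n : ZMod D)‖ : ℝ) : ℂ) * lamZero c' D j n / (Nat.totient n : ℂ) * A n * B n‖ ≤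
      2 * Real.exp 1024 * ell D ^ 9 * (C / ell D ^ 15 * (Kp * (KA + KB) + C / ell D ^ 15)) +
        2 * (Real.exp 1024 * (2 + ell D ^ (1.1 : ℝ))) *
          (C / ell D ^ 7 * (Cw / ell D ^ (18 / 5 : ℝ)) + Kp ^ 2 * KA * KB) := by
  classical
  have hL' : 2 ≤ Real.log D := hL
  have hL0 : 0 < ell D := by linarith
  have hP1 : 1 ≤ bigP D := by rw [bigP]; exact Real.one_le_exp (pow_nonneg (ell_nonneg D) 9)
  have hPa1 : 1 < bigP D ^ a := by
    rw [bigP, ← Real.exp_mul]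
    exact Real.one_lt_exp_iff.mpr (by positivity)
  have hT1 : 1 < bigT D := by rw [bigT]; exact Real.one_lt_exp_iff.mpr (by positivity)
  have hb' : bigP D ^ b ≤ Skeleton.P1 D := Real.rpow_le_rpow_of_exponent_le hP1 hb
  have h11pos : 0 ≤ ell D ^ (1.1 : ℝ) := Real.rpow_nonneg hL0.le _
  set δ : ℝ := C / ell D ^ 15 with hδ
  set δ₇ : ℝ := C / ell D ^ 7 with hδ₇
  set δw : ℝ := Cw / ell D ^ (18 / 5 : ℝ) with hδw
  have hδ0 : 0 ≤ δ := by positivity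
  have hδ₇0 : 0 ≤ δ₇ := by positivity
  have hδw0 : 0 ≤ δw := div_nonneg hCw (Real.rpow_nonneg hL0.le _)
  set cM : ℝ := δ * (Kp * (KA + KB) + δ) with hcM
  set cW : ℝ := δ₇ * δw + Kp ^ 2 * KA * KB with hcW
  set F := (Ico 1 (Nsupp D)).filter (fun n : ℕ => bigP D ^ a ≤ (n : ℝ) ∧ (n : ℝ) < bigP D ^ b)
    with hF
  rw [Sj23Range_eq_sum_divisors c' χ hL j hb', Finset.mul_sum, ← Finset.sum_sub_distrib]
  -- pointwise bound
  have hpt : ∀ n ∈ F, ‖(∑ r ∈ n.divisors, sj23Term c' χ j r (n / r)) -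
      p ^ 2 * (((‖χ (n : ZMod D)‖ : ℝ) : ℂ) * lamZero c' D j n / (Nat.totient n : ℂ) * A n * B n)‖ ≤
      if bigP D ^ a < (n : ℝ) ∧ (n : ℝ) ≤ bigP D ^ b / bigT D then
        ((n : ℝ) / Nat.totient n) ^ 9 / n * cM else ((n : ℝ) / Nat.totient n) ^ 9 / n * cW := by
    intro n hn
    rw [hF, mem_filter, mem_Ico] at hn
    obtain ⟨⟨hn1, -⟩, hna, hnb⟩ := hn
    obtain ⟨hAn, hBn⟩ := hAB n hna hnb
    rw [sum_divisors_sj23Term_eq c' χ hL j hn1]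
    split_ifs with hmain
    · exact perN_main_rel c' χ hq j hn1 hδ0 hKp hAn hBn hp (h1m n hmain.1 hmain.2)
        (h2m n hmain.1 hmain.2)
    · have hwin : (bigP D ^ a / bigT D < n ∧ (n : ℝ) ≤ bigP D ^ a) ∨
          (bigP D ^ b / bigT D < n ∧ (n : ℝ) < bigP D ^ b) := by
        rcases not_and_or.mp hmain with h | h
        · exact Or.inl ⟨lt_of_lt_of_le (div_lt_self (by linarith) hT1) hna, not_lt.mp h⟩
        · exact Or.inr ⟨not_le.mp h, hnb⟩
      calc _ ≤ ‖((‖χ (n : ZMod D)‖ : ℝ) : ℂ) * lamZero c' D j n / (n : ℂ) * frakv1 c' χ j (n : ℝ) *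
              (∑ r ∈ n.divisors with Squarefree r, frakv2 c' χ j (n / r) r / (Nat.totient r : ℂ))‖ +
            ‖p ^ 2 * (((‖χ (n : ZMod D)‖ : ℝ) : ℂ) * lamZero c' D j n / (Nat.totient n : ℂ) *
              A n * B n)‖ := norm_sub_le _ _
        _ ≤ ((n : ℝ) / Nat.totient n) ^ 9 / n * (δ₇ * δw) +
            ((n : ℝ) / Nat.totient n) ^ 9 / n * (Kp ^ 2 * KA * KB) :=
          add_le_add (perN_window_rel c' χ j hn1 hδ₇0 hδw0 (h1w n hwin) (h2w n hwin))
            (perN_mainTerm_le9 c' χ j hn1 hAn hBn hp)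
        _ = ((n : ℝ) / Nat.totient n) ^ 9 / n * cW := by rw [hcW]; ring
  refine (norm_sum_le _ _).trans ((Finset.sum_le_sum hpt).trans ?_)
  rw [Finset.sum_ite, ← Finset.sum_mul, ← Finset.sum_mul]
  -- the bulk
  have hbulk : ∑ n ∈ F.filter (fun n : ℕ => bigP D ^ a < (n : ℝ) ∧ (n : ℝ) ≤ bigP D ^ b / bigT D),
      ((n : ℝ) / Nat.totient n) ^ 9 / n ≤ 2 * Real.exp 1024 * ell D ^ 9 := by
    refine mass_bulk_le9 hL fun n hn => ?_
    rw [mem_filter, hF, mem_filter, mem_Ico] at hn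
    obtain ⟨⟨⟨_, hnN⟩, hna, _⟩, _, _⟩ := hn
    refine ⟨?_, hnN.le⟩
    have : (1 : ℝ) < n := lt_of_lt_of_le hPa1 hna
    have : 1 < n := by exact_mod_cast this
    omega
  -- the windows
  have hwin : ∑ n ∈ F.filter (fun n : ℕ => ¬(bigP D ^ a < (n : ℝ) ∧ (n : ℝ) ≤ bigP D ^ b / bigT D)),
      ((n : ℝ) / Nat.totient n) ^ 9 / n ≤ 2 * (Real.exp 1024 * (2 + ell D ^ (1.1 : ℝ))) := by
    rw [← Finset.sum_filter_add_sum_filter_not _ (fun n : ℕ => (n : ℝ) ≤ bigP D ^ a), two_mul]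
    refine add_le_add ?_ ?_
    · refine mass_window_le9 hL (c := a) ha fun n hn => ?_
      rw [mem_filter, mem_filter, hF, mem_filter] at hn
      obtain ⟨⟨⟨_, hna, _⟩, _⟩, hle⟩ := hn
      exact ⟨lt_of_lt_of_le (div_lt_self (by linarith) hT1) hna, hle⟩
    · refine mass_window_le9 hL (c := b) (by linarith) fun n hn => ?_
      rw [mem_filter, mem_filter, hF, mem_filter] at hn
      obtain ⟨⟨⟨_, _, hnb⟩, hnot⟩, hle⟩ := hn
      refine ⟨?_, hnb.le⟩
      rcases not_and_or.mp hnot with h | h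
      · exact absurd (not_le.mp hle) h
      · exact not_le.mp h
  have hcM0 : 0 ≤ cM := by positivity
  have hcW0 : 0 ≤ cW := by positivity
  exact add_le_add (mul_le_mul_of_nonneg_right hbulk hcM0 |>.trans_eq (by ring))
    (mul_le_mul_of_nonneg_right hwin hcW0 |>.trans_eq (by ring))

end EngineRel

/-! ### The two main ranges from Lemma 10.1 and the RELATIVE Lemma 10.2 -/

section MainRangesRel

variable {D : ℕ}

/-- The window rate identity `𝓛^{1.1}/(𝓛⁷·𝓛^{18/5}) = 1/(𝓛⁹·𝓛^{1/2})` (`1.1 + 1/2 + 2 = 18/5`). [folklore] -/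
private theorem window_rate_eq {L : ℝ} (hL : 0 < L) :
    L ^ (1.1 : ℝ) / (L ^ 7 * L ^ (18 / 5 : ℝ)) = 1 / (L ^ 9 * L ^ (1 / 2 : ℝ)) := by
  have hsplit : L ^ (18 / 5 : ℝ) = L ^ (1.1 : ℝ) * L ^ (1 / 2 : ℝ) * L ^ 2 := by
    rw [← Real.rpow_natCast L 2, ← Real.rpow_add hL, ← Real.rpow_add hL]
    norm_num
  have h1 : 0 < L ^ (1.1 : ℝ) := Real.rpow_pos_of_pos hL _
  have h2 : 0 < L ^ (1 / 2 : ℝ) := Real.rpow_pos_of_pos hL _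
  rw [hsplit]
  field_simp

/-- The final numerics of a main range over the relative Lemma 10.2: with `K_p = k𝓛⁻⁷` the explicit error
of `range_estimate_rel` is `≤ A𝓛⁻⁹𝓛^{−1/2} + B𝓛⁻¹²` (`A = 6e^{1024}CC_w`), hence `≤ εα = επ𝓛⁻⁹` once
`𝓛^{1/2} ≥ 2A/(επ)` and `𝓛 ≥ 2B/(επ)`. [folklore] -/
private theorem numeric_bound_rel {L ε C Cw k KA KB : ℝ} (hL2 : 2 ≤ L) (hε : 0 < ε) (hC : 0 ≤ C)
    (hCw : 0 ≤ Cw) (hk : 0 ≤ k) (hKA : 0 ≤ KA) (hKB : 0 ≤ KB)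
    (hA : 2 * (6 * Real.exp 1024 * C * Cw) / (ε * π) ≤ L ^ (1 / 2 : ℝ))
    (hB : 2 * (2 * Real.exp 1024 * (C * k * (KA + KB) + C ^ 2) +
      6 * Real.exp 1024 * k ^ 2 * KA * KB) / (ε * π) ≤ L) :
    2 * Real.exp 1024 * L ^ 9 * (C / L ^ 15 * (k / L ^ 7 * (KA + KB) + C / L ^ 15)) +
        2 * (Real.exp 1024 * (2 + L ^ (1.1 : ℝ))) *
          (C / L ^ 7 * (Cw / L ^ (18 / 5 : ℝ)) + (k / L ^ 7) ^ 2 * KA * KB) ≤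
      ε * (π / L ^ 9) := by
  have hL0 : 0 < L := by linarith
  have hL1 : 1 ≤ L := by linarith
  have hεπ : 0 < ε * π := by positivity
  set A : ℝ := 6 * Real.exp 1024 * C * Cw with hAdef
  set B : ℝ := 2 * Real.exp 1024 * (C * k * (KA + KB) + C ^ 2) +
    6 * Real.exp 1024 * k ^ 2 * KA * KB with hBdef
  have hA0 : 0 ≤ A := by positivity
  have hB0 : 0 ≤ B := by positivity
  have hu1 : 1 ≤ L ^ (1.1 : ℝ) := Real.one_le_rpow hL1 (by norm_num)
  have hu2 : L ^ (1.1 : ℝ) ≤ L ^ 2 := by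
    have := Real.rpow_le_rpow_of_exponent_le hL1 (show (1.1 : ℝ) ≤ 2 by norm_num)
    rwa [Real.rpow_two] at this
  have hs0 : 0 < L ^ (1 / 2 : ℝ) := Real.rpow_pos_of_pos hL0 _
  have h185 : 0 < L ^ (18 / 5 : ℝ) := Real.rpow_pos_of_pos hL0 _
  have hpow : ∀ {X : ℝ} (m : ℕ), 0 ≤ X → 12 ≤ m → X / L ^ m ≤ X / L ^ 12 := by
    intro X m hX hm
    exact div_le_div_of_nonneg_left hX (by positivity) (pow_le_pow_right₀ hL1 hm)
  -- term 1 (the bulk)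
  have hT1 : 2 * Real.exp 1024 * L ^ 9 * (C / L ^ 15 * (k / L ^ 7 * (KA + KB) + C / L ^ 15)) ≤
      2 * Real.exp 1024 * (C * k * (KA + KB) + C ^ 2) / L ^ 12 := by
    have e : 2 * Real.exp 1024 * L ^ 9 * (C / L ^ 15 * (k / L ^ 7 * (KA + KB) + C / L ^ 15)) =
        2 * Real.exp 1024 * (C * k * (KA + KB)) / L ^ 13 + 2 * Real.exp 1024 * C ^ 2 / L ^ 21 := by
      field_simp
    rw [e]
    calc 2 * Real.exp 1024 * (C * k * (KA + KB)) / L ^ 13 + 2 * Real.exp 1024 * C ^ 2 / L ^ 21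
        ≤ 2 * Real.exp 1024 * (C * k * (KA + KB)) / L ^ 12 + 2 * Real.exp 1024 * C ^ 2 / L ^ 12 :=
          add_le_add (hpow 13 (by positivity) (by norm_num)) (hpow 21 (by positivity) (by norm_num))
      _ = 2 * Real.exp 1024 * (C * k * (KA + KB) + C ^ 2) / L ^ 12 := by ring
  -- term 2 (the windows)
  have hT2 : 2 * (Real.exp 1024 * (2 + L ^ (1.1 : ℝ))) *
        (C / L ^ 7 * (Cw / L ^ (18 / 5 : ℝ)) + (k / L ^ 7) ^ 2 * KA * KB) ≤
      A / (L ^ 9 * L ^ (1 / 2 : ℝ)) + 6 * Real.exp 1024 * k ^ 2 * KA * KB / L ^ 12 := by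
    have h3 : 2 + L ^ (1.1 : ℝ) ≤ 3 * L ^ (1.1 : ℝ) := by linarith
    have hin0 : 0 ≤ C / L ^ 7 * (Cw / L ^ (18 / 5 : ℝ)) + (k / L ^ 7) ^ 2 * KA * KB := by
      have : 0 ≤ Cw / L ^ (18 / 5 : ℝ) := div_nonneg hCw h185.le
      positivity
    calc 2 * (Real.exp 1024 * (2 + L ^ (1.1 : ℝ))) *
          (C / L ^ 7 * (Cw / L ^ (18 / 5 : ℝ)) + (k / L ^ 7) ^ 2 * KA * KB)
        ≤ 2 * (Real.exp 1024 * (3 * L ^ (1.1 : ℝ))) *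
          (C / L ^ 7 * (Cw / L ^ (18 / 5 : ℝ)) + (k / L ^ 7) ^ 2 * KA * KB) := by
          apply mul_le_mul_of_nonneg_right _ hin0
          exact mul_le_mul_of_nonneg_left (mul_le_mul_of_nonneg_left h3 (Real.exp_pos _).le)
            (by norm_num)
      _ = A * (L ^ (1.1 : ℝ) / (L ^ 7 * L ^ (18 / 5 : ℝ))) +
          6 * Real.exp 1024 * k ^ 2 * KA * KB * (L ^ (1.1 : ℝ) / L ^ 14) := by
          rw [hAdef]
          field_simp
          ring
      _ ≤ A * (1 / (L ^ 9 * L ^ (1 / 2 : ℝ))) + 6 * Real.exp 1024 * k ^ 2 * KA * KB * (1 / L ^ 12) := by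
          refine add_le_add ?_ ?_
          · rw [window_rate_eq hL0]
          · refine mul_le_mul_of_nonneg_left ?_ (by positivity)
            rw [div_le_div_iff₀ (by positivity) (by positivity), one_mul]
            calc L ^ (1.1 : ℝ) * L ^ 12 ≤ L ^ 2 * L ^ 12 := by gcongr
              _ = L ^ 14 := by ring
      _ = A / (L ^ 9 * L ^ (1 / 2 : ℝ)) + 6 * Real.exp 1024 * k ^ 2 * KA * KB / L ^ 12 := by ring
  -- the two halves of `ε`
  have hhalf1 : A / (L ^ 9 * L ^ (1 / 2 : ℝ)) ≤ ε * π / 2 / L ^ 9 := by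
    have hAle : A ≤ ε * π / 2 * L ^ (1 / 2 : ℝ) := by
      have := (div_le_iff₀ hεπ).mp hA
      linarith
    rw [div_le_div_iff₀ (by positivity) (by positivity)]
    calc A * L ^ 9 ≤ (ε * π / 2 * L ^ (1 / 2 : ℝ)) * L ^ 9 := by gcongr
      _ = ε * π / 2 * (L ^ 9 * L ^ (1 / 2 : ℝ)) := by ring
  have hhalf2 : B / L ^ 12 ≤ ε * π / 2 / L ^ 9 := by
    have hBle : B ≤ ε * π / 2 * L := by
      have := (div_le_iff₀ hεπ).mp hB
      linarith
    rw [div_le_div_iff₀ (by positivity) (by positivity)]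
    calc B * L ^ 9 ≤ (ε * π / 2 * L) * L ^ 9 := by gcongr
      _ = ε * π / 2 * L ^ 10 := by ring
      _ ≤ ε * π / 2 * L ^ 12 :=
          mul_le_mul_of_nonneg_left (pow_le_pow_right₀ hL1 (by norm_num)) (by positivity)
  have hsum : 2 * Real.exp 1024 * (C * k * (KA + KB) + C ^ 2) / L ^ 12 +
      (A / (L ^ 9 * L ^ (1 / 2 : ℝ)) + 6 * Real.exp 1024 * k ^ 2 * KA * KB / L ^ 12) =
      A / (L ^ 9 * L ^ (1 / 2 : ℝ)) + B / L ^ 12 := by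
    rw [hBdef]; ring
  have e : ε * (π / L ^ 9) = ε * π / 2 / L ^ 9 + ε * π / 2 / L ^ 9 := by ring
  calc _ ≤ 2 * Real.exp 1024 * (C * k * (KA + KB) + C ^ 2) / L ^ 12 +
        (A / (L ^ 9 * L ^ (1 / 2 : ℝ)) + 6 * Real.exp 1024 * k ^ 2 * KA * KB / L ^ 12) :=
        add_le_add hT1 hT2
    _ = A / (L ^ 9 * L ^ (1 / 2 : ℝ)) + B / L ^ 12 := hsum
    _ ≤ ε * (π / L ^ 9) := by rw [e]; exact add_le_add hhalf1 hhalf2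

/-- `x ≤ L^{1/2}` once `x² ≤ L` (`x ≥ 0`). [folklore] -/
private theorem le_rpow_half_of_sq_le {x L : ℝ} (hx : 0 ≤ x) (hL : 0 ≤ L) (h : x ^ 2 ≤ L) :
    x ≤ L ^ (1 / 2 : ℝ) := by
  rw [← Real.sqrt_eq_rpow L]
  exact (Real.le_sqrt hx hL).mpr h


/-- **Kernel edge `Z22:§18.u010 ⇐ Lemma 10.1 + the RELATIVE Lemma 10.2`**: "the sum over
`P^{0.5} ≤ dr < P^{0.502}` is equal to `(500L′(1,χ)/log P)² Σ_{P^{0.5} ≤ n < P^{0.502}}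
|χ(n)|λ₀ⱼ(n)/φ(n)(−1 − β_j log(n/P^{0.5}))(−1 + 𝒴₁ⱼ(n)) + o(α)`" (Z22 p.100, tex L4932–L4937) FOLLOWS from
`Skeleton.Lemma101 c′` ((10.3), (10.5)) and the relative clauses of Lemma 10.2 — (10.9) with the error
`C𝓛⁻¹⁵(∏_{q∣dr}(1−q⁻¹)⁻¹)²` (stated inline, verbatim the second clause of `Skeleton.Lemma102Rel`) and the
window clause with the rate `C𝓛^{−18/5}(∏_{q∣dr}(1−q⁻¹)⁻¹)²` — by `range_estimate_rel` (error
`O_{c′}(𝓛^{−9.5}) = o(α)`). [cite: Zhang2022LandauSiegel, §18 p.100; §10 Lemmas 10.1–10.2] -/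
theorem step18_u010_of_rel (h101 : Skeleton.Lemma101 c')
    (hmain : ∃ C : ℝ, ForAllLarge fun D _ χ => AssumptionA D χ →
      ∀ j ∈ ({1, 2, 3} : Finset ℕ), ∀ d r : ℕ, 1 ≤ d → 1 ≤ r →
        (((d * r : ℕ) : ℝ) ≤ bigP D ^ (0.5 : ℝ) / bigT D →
          ‖frakv2 c' χ j d r - deriv χ.LFunction 1 * PiW χ d r / 500 *
            (betaJ c' D (j + 1) * betaJ c' D (j + 2)) * Real.log (bigP D)‖ ≤
              C * (ell D ^ 15)⁻¹ * (∏ q ∈ (d * r).primeFactors, (1 - (q : ℝ)⁻¹)⁻¹) ^ 2) ∧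
        (bigP D ^ (0.5 : ℝ) < ((d * r : ℕ) : ℝ) → ((d * r : ℕ) : ℝ) ≤ bigP D ^ (0.502 : ℝ) / bigT D →
          ‖frakv2 c' χ j d r - 500 * deriv χ.LFunction 1 * PiW χ d r / Real.log (bigP D) *
            (-1 + fraky1 c' D j ((d * r : ℕ) : ℝ))‖ ≤
              C * (ell D ^ 15)⁻¹ * (∏ q ∈ (d * r).primeFactors, (1 - (q : ℝ)⁻¹)⁻¹) ^ 2) ∧
        (bigP D ^ (0.502 : ℝ) < ((d * r : ℕ) : ℝ) →
          ((d * r : ℕ) : ℝ) ≤ bigP D ^ (0.504 : ℝ) / bigT D →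
          ‖frakv2 c' χ j d r - 500 * deriv χ.LFunction 1 * PiW χ d r / Real.log (bigP D) *
            (1 + fraky2 c' D j ((d * r : ℕ) : ℝ))‖ ≤
              C * (ell D ^ 15)⁻¹ * (∏ q ∈ (d * r).primeFactors, (1 - (q : ℝ)⁻¹)⁻¹) ^ 2))
    (hwin : ∃ C : ℝ, ForAllLarge fun D _ χ => AssumptionA D χ →
      ∀ j ∈ ({1, 2, 3} : Finset ℕ), ∀ d r : ℕ, 1 ≤ d → 1 ≤ r →
        ((bigP D ^ (0.5 : ℝ) / bigT D < ((d * r : ℕ) : ℝ) ∧ ((d * r : ℕ) : ℝ) ≤ bigP D ^ (0.5 : ℝ)) ∨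
            (bigP D ^ (0.502 : ℝ) / bigT D < ((d * r : ℕ) : ℝ) ∧
              ((d * r : ℕ) : ℝ) ≤ bigP D ^ (0.502 : ℝ)) ∨
            (bigP D ^ (0.504 : ℝ) / bigT D < ((d * r : ℕ) : ℝ) ∧
              ((d * r : ℕ) : ℝ) < bigP D ^ (0.504 : ℝ)) →
          ‖frakv2 c' χ j d r‖ ≤
            C * (ell D ^ (18 / 5 : ℝ))⁻¹ * (∏ q ∈ (d * r).primeFactors, (1 - (q : ℝ)⁻¹)⁻¹) ^ 2)) :
    Step18_u010 c' := by
  intro ε hε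
  obtain ⟨c, _, C₁, D₁, h1⟩ := h101
  obtain ⟨C₂, D₂, h2⟩ := hmain
  obtain ⟨C₃, D₃, h3⟩ := hwin
  set C : ℝ := max (max (max C₁ C₂) C₃) 0 with hCdef
  have hC0 : 0 ≤ C := le_max_right _ _
  have hC1 : C₁ ≤ C := le_trans (le_trans (le_max_left _ _) (le_max_left _ _)) (le_max_left _ _)
  have hC2 : C₂ ≤ C := le_trans (le_trans (le_max_right _ _) (le_max_left _ _)) (le_max_left _ _)
  have hC3 : C₃ ≤ C := le_trans (le_max_right _ _) (le_max_left _ _)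
  set b : ℝ := 3 * π * (1 + 5 * |c'|) with hb
  have hb0 : 0 ≤ b := by positivity
  set KA : ℝ := 1 + 2 * b with hKA
  set KB : ℝ := 1 + (4 * b + 6 * b ^ 2) with hKB
  have hKA0 : 0 ≤ KA := by positivity
  have hKB0 : 0 ≤ KB := by positivity
  set k : ℝ := 2000 * Real.exp 4.5 with hk
  have hk0 : 0 ≤ k := by positivity
  set A : ℝ := 6 * Real.exp 1024 * C * C with hAdef
  set B : ℝ := 2 * Real.exp 1024 * (C * k * (KA + KB) + C ^ 2) +
    6 * Real.exp 1024 * k ^ 2 * KA * KB with hBdef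
  have hA0 : 0 ≤ A := by positivity
  have hB0 : 0 ≤ B := by positivity
  obtain ⟨D₉, hD₉⟩ := exists_ell_ge' (max 3 (max ((2 * A / (ε * π)) ^ 2) (2 * B / (ε * π))))
  refine ⟨max (max (max D₁ D₂) D₃) D₉, fun D _ χ hD hq hp hA j hj => ?_⟩
  have hD1 : D₁ ≤ D :=
    le_trans (le_trans (le_trans (le_max_left _ _) (le_max_left _ _)) (le_max_left _ _)) hD
  have hD2 : D₂ ≤ D :=
    le_trans (le_trans (le_trans (le_max_right _ _) (le_max_left _ _)) (le_max_left _ _)) hD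
  have hD3 : D₃ ≤ D := le_trans (le_trans (le_max_right _ _) (le_max_left _ _)) hD
  have hℓ : max 3 (max ((2 * A / (ε * π)) ^ 2) (2 * B / (ε * π))) ≤ ell D :=
    hD₉ D (le_trans (le_max_right _ _) hD)
  have hL3 : 3 ≤ ell D := le_trans (le_max_left _ _) hℓ
  have hAL : (2 * A / (ε * π)) ^ 2 ≤ ell D := le_trans (le_trans (le_max_left _ _) (le_max_right _ _)) hℓ
  have hBL : 2 * B / (ε * π) ≤ ell D := le_trans (le_trans (le_max_right _ _) (le_max_right _ _)) hℓ
  have hL1 : 1 ≤ ell D := by linarith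
  have hL2 : 2 ≤ ell D := by linarith
  have hL0 : 0 ≤ ell D := by linarith
  have hAL' : 2 * A / (ε * π) ≤ ell D ^ (1 / 2 : ℝ) :=
    le_rpow_half_of_sq_le (by positivity) hL0 hAL
  have h1D := h1 D χ hD1 hq hp hA j hj
  have h2D := h2 D χ hD2 hq hp hA j hj
  have h3D := h3 D χ hD3 hq hp hA j hj
  have hpK := norm_prefactor_le χ hL3 hp
  have h185 : 0 < ell D ^ (18 / 5 : ℝ) := Real.rpow_pos_of_pos (by linarith) _
  have hR := range_estimate_rel c' χ hq hL2 j (a := 0.5) (b := 0.502) (by norm_num) (by norm_num)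
    (by norm_num) (fun n : ℕ => -1 - betaJ c' D j * (Real.log ((n : ℝ) / bigP D ^ (0.5 : ℝ)) : ℂ))
    (fun n : ℕ => -1 + fraky1 c' D j n) (500 * deriv χ.LFunction 1 / (Real.log (bigP D) : ℂ))
    hC0 hC0 hKA0 hKB0 (by positivity) hpK ?_ ?_ ?_ ?_ ?_
  · rw [alpha_eq']
    exact hR.trans (numeric_bound_rel hL2 hε hC0 hC0 hk0 hKA0 hKB0 hAL' hBL)
  · -- the factor bounds
    intro n hna hnb
    have hnI := mem_Ico_Nsupp_of_range hL2 (by norm_num) (by norm_num) hna hnb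
    have hf := Sec18SjNorm.norm_factors_le c' hL2 j hnI
    exact ⟨hf.1, hf.2.2.1⟩
  · -- Lemma 10.1, (10.3)
    intro n hlo hhi
    exact ((h1D n).2.1 hlo hhi).trans (mul_inv_le_div' 15 hC1 hL0)
  · -- relative Lemma 10.2, (10.9)
    intro n hlo hhi r hr _
    have hn1 : 1 ≤ n := by
      have : (1 : ℝ) ≤ n := le_trans (one_le_Ppow'' D (by norm_num)) hlo.le
      exact_mod_cast this
    have hn0 : n ≠ 0 := by omega
    have hrn : r ∣ n := Nat.dvd_of_mem_divisors hr
    have hr1 : 1 ≤ r := Nat.pos_of_dvd_of_pos hrn (by omega)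
    have hd1 : 1 ≤ n / r := Nat.div_pos (Nat.le_of_dvd (by omega) hrn) (by omega)
    have h := (h2D (n / r) r hd1 hr1).2.1
    rw [Nat.div_mul_cancel hrn] at h
    have h' := h hlo hhi
    have e : 500 * deriv χ.LFunction 1 * PiW χ (n / r) r / (Real.log (bigP D) : ℂ) *
        (-1 + fraky1 c' D j (n : ℝ)) =
        500 * deriv χ.LFunction 1 / (Real.log (bigP D) : ℂ) * PiW χ (n / r) r *
          (-1 + fraky1 c' D j n) := by ring
    rw [e, prod_one_sub_inv_inv_sq_eq' hn0] at h'
    refine h'.trans (mul_le_mul_of_nonneg_right (mul_inv_le_div' 15 hC2 hL0) (by positivity))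
  · -- Lemma 10.1, (10.5)
    intro n hw
    refine ((h1D n).2.2.2 ?_).trans (mul_inv_le_div' 7 hC1 hL0)
    rcases hw with h | h
    · exact Or.inl h
    · exact Or.inr (Or.inl ⟨h.1, h.2.le⟩)
  · -- relative Lemma 10.2, window clause
    intro n hw r hr _
    have hn1 : 1 ≤ n := by
      rcases hw with h | h
      · exact one_le_of_window hL2 (by norm_num) h.1
      · exact one_le_of_window hL2 (by norm_num) h.1
    have hn0 : n ≠ 0 := by omega
    have hrn : r ∣ n := Nat.dvd_of_mem_divisors hr
    have hr1 : 1 ≤ r := Nat.pos_of_dvd_of_pos hrn (by omega)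
    have hd1 : 1 ≤ n / r := Nat.div_pos (Nat.le_of_dvd (by omega) hrn) (by omega)
    have h := h3D (n / r) r hd1 hr1
    rw [Nat.div_mul_cancel hrn, prod_one_sub_inv_inv_sq_eq' hn0] at h
    have h' : ‖frakv2 c' χ j (n / r) r‖ ≤
        C₃ * (ell D ^ (18 / 5 : ℝ))⁻¹ * ((n : ℝ) / Nat.totient n) ^ 2 := by
      refine h ?_
      rcases hw with h | h
      · exact Or.inl h
      · exact Or.inr (Or.inl ⟨h.1, h.2.le⟩)
    refine h'.trans (mul_le_mul_of_nonneg_right ?_ (by positivity))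
    rw [div_eq_mul_inv]
    exact mul_le_mul_of_nonneg_right hC3 (inv_nonneg.mpr h185.le)

/-- **Kernel edge `Z22:§18.u011` (READING `𝒴₂ⱼ` of (10.10)) `⇐ Lemma 10.1 + the RELATIVE Lemma 10.2`**:
"the sum over `P^{0.502} ≤ dr < P^{0.504}` is equal to `(500L′(1,χ)/log P)² Σ_{P^{0.502} ≤ n < P^{0.504}}
|χ(n)|λ₀ⱼ(n)/φ(n)(1 − β_j log(P^{0.504}/n))(1 + 𝒴₂ⱼ(n)) + o(α)`" — the typed reading `Step18_u011b`
(Z22 p.100, tex L4938–L4942 with (10.10)) FOLLOWS from `Skeleton.Lemma101 c′` ((10.4), (10.5)) and the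
relative clauses of Lemma 10.2 ((10.10) with the error `C𝓛⁻¹⁵(∏_{q∣dr}(1−q⁻¹)⁻¹)²`, the window clause with
the rate `C𝓛^{−18/5}(∏_{q∣dr}(1−q⁻¹)⁻¹)²`) by `range_estimate_rel`.
[cite: Zhang2022LandauSiegel, §18 p.100; §10 Lemmas 10.1–10.2] -/
theorem step18_u011b_of_rel (h101 : Skeleton.Lemma101 c')
    (hmain : ∃ C : ℝ, ForAllLarge fun D _ χ => AssumptionA D χ →
      ∀ j ∈ ({1, 2, 3} : Finset ℕ), ∀ d r : ℕ, 1 ≤ d → 1 ≤ r →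
        (((d * r : ℕ) : ℝ) ≤ bigP D ^ (0.5 : ℝ) / bigT D →
          ‖frakv2 c' χ j d r - deriv χ.LFunction 1 * PiW χ d r / 500 *
            (betaJ c' D (j + 1) * betaJ c' D (j + 2)) * Real.log (bigP D)‖ ≤
              C * (ell D ^ 15)⁻¹ * (∏ q ∈ (d * r).primeFactors, (1 - (q : ℝ)⁻¹)⁻¹) ^ 2) ∧
        (bigP D ^ (0.5 : ℝ) < ((d * r : ℕ) : ℝ) → ((d * r : ℕ) : ℝ) ≤ bigP D ^ (0.502 : ℝ) / bigT D →
          ‖frakv2 c' χ j d r - 500 * deriv χ.LFunction 1 * PiW χ d r / Real.log (bigP D) *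
            (-1 + fraky1 c' D j ((d * r : ℕ) : ℝ))‖ ≤
              C * (ell D ^ 15)⁻¹ * (∏ q ∈ (d * r).primeFactors, (1 - (q : ℝ)⁻¹)⁻¹) ^ 2) ∧
        (bigP D ^ (0.502 : ℝ) < ((d * r : ℕ) : ℝ) →
          ((d * r : ℕ) : ℝ) ≤ bigP D ^ (0.504 : ℝ) / bigT D →
          ‖frakv2 c' χ j d r - 500 * deriv χ.LFunction 1 * PiW χ d r / Real.log (bigP D) *
            (1 + fraky2 c' D j ((d * r : ℕ) : ℝ))‖ ≤
              C * (ell D ^ 15)⁻¹ * (∏ q ∈ (d * r).primeFactors, (1 - (q : ℝ)⁻¹)⁻¹) ^ 2))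
    (hwin : ∃ C : ℝ, ForAllLarge fun D _ χ => AssumptionA D χ →
      ∀ j ∈ ({1, 2, 3} : Finset ℕ), ∀ d r : ℕ, 1 ≤ d → 1 ≤ r →
        ((bigP D ^ (0.5 : ℝ) / bigT D < ((d * r : ℕ) : ℝ) ∧ ((d * r : ℕ) : ℝ) ≤ bigP D ^ (0.5 : ℝ)) ∨
            (bigP D ^ (0.502 : ℝ) / bigT D < ((d * r : ℕ) : ℝ) ∧
              ((d * r : ℕ) : ℝ) ≤ bigP D ^ (0.502 : ℝ)) ∨
            (bigP D ^ (0.504 : ℝ) / bigT D < ((d * r : ℕ) : ℝ) ∧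
              ((d * r : ℕ) : ℝ) < bigP D ^ (0.504 : ℝ)) →
          ‖frakv2 c' χ j d r‖ ≤
            C * (ell D ^ (18 / 5 : ℝ))⁻¹ * (∏ q ∈ (d * r).primeFactors, (1 - (q : ℝ)⁻¹)⁻¹) ^ 2)) :
    Step18_u011b c' := by
  intro ε hε
  obtain ⟨c, _, C₁, D₁, h1⟩ := h101
  obtain ⟨C₂, D₂, h2⟩ := hmain
  obtain ⟨C₃, D₃, h3⟩ := hwin
  set C : ℝ := max (max (max C₁ C₂) C₃) 0 with hCdef
  have hC0 : 0 ≤ C := le_max_right _ _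
  have hC1 : C₁ ≤ C := le_trans (le_trans (le_max_left _ _) (le_max_left _ _)) (le_max_left _ _)
  have hC2 : C₂ ≤ C := le_trans (le_trans (le_max_right _ _) (le_max_left _ _)) (le_max_left _ _)
  have hC3 : C₃ ≤ C := le_trans (le_max_right _ _) (le_max_left _ _)
  set b : ℝ := 3 * π * (1 + 5 * |c'|) with hb
  have hb0 : 0 ≤ b := by positivity
  set KA : ℝ := 1 + 2 * b with hKA
  set KB : ℝ := 1 + (4 * b + 6 * b ^ 2) with hKB
  have hKA0 : 0 ≤ KA := by positivity
  have hKB0 : 0 ≤ KB := by positivity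
  set k : ℝ := 2000 * Real.exp 4.5 with hk
  have hk0 : 0 ≤ k := by positivity
  set A : ℝ := 6 * Real.exp 1024 * C * C with hAdef
  set B : ℝ := 2 * Real.exp 1024 * (C * k * (KA + KB) + C ^ 2) +
    6 * Real.exp 1024 * k ^ 2 * KA * KB with hBdef
  have hA0 : 0 ≤ A := by positivity
  have hB0 : 0 ≤ B := by positivity
  obtain ⟨D₉, hD₉⟩ := exists_ell_ge' (max 3 (max ((2 * A / (ε * π)) ^ 2) (2 * B / (ε * π))))
  refine ⟨max (max (max D₁ D₂) D₃) D₉, fun D _ χ hD hq hp hA j hj => ?_⟩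
  have hD1 : D₁ ≤ D :=
    le_trans (le_trans (le_trans (le_max_left _ _) (le_max_left _ _)) (le_max_left _ _)) hD
  have hD2 : D₂ ≤ D :=
    le_trans (le_trans (le_trans (le_max_right _ _) (le_max_left _ _)) (le_max_left _ _)) hD
  have hD3 : D₃ ≤ D := le_trans (le_trans (le_max_right _ _) (le_max_left _ _)) hD
  have hℓ : max 3 (max ((2 * A / (ε * π)) ^ 2) (2 * B / (ε * π))) ≤ ell D :=
    hD₉ D (le_trans (le_max_right _ _) hD)
  have hL3 : 3 ≤ ell D := le_trans (le_max_left _ _) hℓ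
  have hAL : (2 * A / (ε * π)) ^ 2 ≤ ell D := le_trans (le_trans (le_max_left _ _) (le_max_right _ _)) hℓ
  have hBL : 2 * B / (ε * π) ≤ ell D := le_trans (le_trans (le_max_right _ _) (le_max_right _ _)) hℓ
  have hL1 : 1 ≤ ell D := by linarith
  have hL2 : 2 ≤ ell D := by linarith
  have hL0 : 0 ≤ ell D := by linarith
  have hAL' : 2 * A / (ε * π) ≤ ell D ^ (1 / 2 : ℝ) :=
    le_rpow_half_of_sq_le (by positivity) hL0 hAL
  have h1D := h1 D χ hD1 hq hp hA j hj
  have h2D := h2 D χ hD2 hq hp hA j hj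
  have h3D := h3 D χ hD3 hq hp hA j hj
  have hpK := norm_prefactor_le χ hL3 hp
  have h185 : 0 < ell D ^ (18 / 5 : ℝ) := Real.rpow_pos_of_pos (by linarith) _
  have hR := range_estimate_rel c' χ hq hL2 j (a := 0.502) (b := 0.504) (by norm_num) (by norm_num)
    (by norm_num) (fun n : ℕ => 1 - betaJ c' D j * (Real.log (bigP D ^ (0.504 : ℝ) / n) : ℂ))
    (fun n : ℕ => 1 + fraky2 c' D j n) (500 * deriv χ.LFunction 1 / (Real.log (bigP D) : ℂ))
    hC0 hC0 hKA0 hKB0 (by positivity) hpK ?_ ?_ ?_ ?_ ?_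
  · rw [alpha_eq']
    exact hR.trans (numeric_bound_rel hL2 hε hC0 hC0 hk0 hKA0 hKB0 hAL' hBL)
  · -- the factor bounds
    intro n hna hnb
    have hnI := mem_Ico_Nsupp_of_range hL2 (by norm_num) (by norm_num) hna hnb
    have hf := Sec18SjNorm.norm_factors_le c' hL2 j hnI
    refine ⟨hf.2.1, ?_⟩
    calc ‖(1 + fraky2 c' D j n)‖ ≤ ‖(1 : ℂ)‖ + ‖fraky2 c' D j n‖ := norm_add_le _ _
      _ ≤ 1 + (4 * b + 6 * b ^ 2) := by
          rw [norm_one]; exact add_le_add le_rfl (norm_fraky2_le c' hL2 j hnI)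
  · -- Lemma 10.1, (10.4)
    intro n hlo hhi
    exact ((h1D n).2.2.1 hlo hhi).trans (mul_inv_le_div' 15 hC1 hL0)
  · -- relative Lemma 10.2, (10.10)
    intro n hlo hhi r hr _
    have hn1 : 1 ≤ n := by
      have : (1 : ℝ) ≤ n := le_trans (one_le_Ppow'' D (by norm_num)) hlo.le
      exact_mod_cast this
    have hn0 : n ≠ 0 := by omega
    have hrn : r ∣ n := Nat.dvd_of_mem_divisors hr
    have hr1 : 1 ≤ r := Nat.pos_of_dvd_of_pos hrn (by omega)
    have hd1 : 1 ≤ n / r := Nat.div_pos (Nat.le_of_dvd (by omega) hrn) (by omega)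
    have h := (h2D (n / r) r hd1 hr1).2.2
    rw [Nat.div_mul_cancel hrn] at h
    have h' := h hlo hhi
    have e : 500 * deriv χ.LFunction 1 * PiW χ (n / r) r / (Real.log (bigP D) : ℂ) *
        (1 + fraky2 c' D j (n : ℝ)) =
        500 * deriv χ.LFunction 1 / (Real.log (bigP D) : ℂ) * PiW χ (n / r) r *
          (1 + fraky2 c' D j n) := by ring
    rw [e, prod_one_sub_inv_inv_sq_eq' hn0] at h'
    refine h'.trans (mul_le_mul_of_nonneg_right (mul_inv_le_div' 15 hC2 hL0) (by positivity))
  · -- Lemma 10.1, (10.5)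
    intro n hw
    refine ((h1D n).2.2.2 ?_).trans (mul_inv_le_div' 7 hC1 hL0)
    rcases hw with h | h
    · exact Or.inr (Or.inl h)
    · exact Or.inr (Or.inr h)
  · -- relative Lemma 10.2, window clause
    intro n hw r hr _
    have hn1 : 1 ≤ n := by
      rcases hw with h | h
      · exact one_le_of_window hL2 (by norm_num) h.1
      · exact one_le_of_window hL2 (by norm_num) h.1
    have hn0 : n ≠ 0 := by omega
    have hrn : r ∣ n := Nat.dvd_of_mem_divisors hr
    have hr1 : 1 ≤ r := Nat.pos_of_dvd_of_pos hrn (by omega)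
    have hd1 : 1 ≤ n / r := Nat.div_pos (Nat.le_of_dvd (by omega) hrn) (by omega)
    have h := h3D (n / r) r hd1 hr1
    rw [Nat.div_mul_cancel hrn, prod_one_sub_inv_inv_sq_eq' hn0] at h
    have h' : ‖frakv2 c' χ j (n / r) r‖ ≤
        C₃ * (ell D ^ (18 / 5 : ℝ))⁻¹ * ((n : ℝ) / Nat.totient n) ^ 2 := by
      refine h ?_
      rcases hw with h | h
      · exact Or.inr (Or.inl h)
      · exact Or.inr (Or.inr h)
    refine h'.trans (mul_le_mul_of_nonneg_right ?_ (by positivity))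
    rw [div_eq_mul_inv]
    exact mul_le_mul_of_nonneg_right hC3 (inv_nonneg.mpr h185.le)

end MainRangesRel

/-! ### The first range `dr < P^{0.5}` from Lemma 10.1 and the RELATIVE Lemma 10.2 -/

section Range1Rel

variable {D : ℕ} [NeZero D] (χ : DirichletCharacter ℂ D)

omit [NeZero D] χ in
/-- `(∏_{q∣n}(1 − q⁻¹)⁻¹)² ≤ ∏_{q∣n}(1 + 2/q)²` (`(1 − q⁻¹)⁻¹ = q/(q−1) ≤ 1 + 2/q` for `q ≥ 2`).
[cite: HallTenenbaum1988, §0.2] -/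
private theorem prod_one_sub_inv_inv_sq_le_prod2 (n : ℕ) :
    (∏ q ∈ n.primeFactors, (1 - (q : ℝ)⁻¹)⁻¹) ^ 2 ≤ ∏ q ∈ n.primeFactors, (1 + 2 / (q : ℝ)) ^ 2 := by
  rw [← Finset.prod_pow]
  refine Finset.prod_le_prod (fun q _ => sq_nonneg _) fun q hq => ?_
  have hq2 : (2 : ℝ) ≤ q := by exact_mod_cast (Nat.prime_of_mem_primeFactors hq).two_le
  have hq0 : (0 : ℝ) < q := by linarith
  have hinv : (1 - (q : ℝ)⁻¹)⁻¹ = q / (q - 1) := by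
    field_simp
  have hle : (1 - (q : ℝ)⁻¹)⁻¹ ≤ 1 + 2 / (q : ℝ) := by
    rw [hinv, show 1 + 2 / (q : ℝ) = (q + 2) / q by field_simp, div_le_div_iff₀ (by linarith) hq0]
    nlinarith
  have h0 : 0 ≤ (1 - (q : ℝ)⁻¹)⁻¹ := by
    rw [hinv]; exact div_nonneg hq0.le (by linarith)
  exact pow_le_pow_left₀ h0 hle 2

set_option maxHeartbeats 400000 in
/-- **The first-range estimate at a fixed `D`, relative Lemma 10.2** (the numerical heart of
`Step18_range1` over RT-01′): for `χ` primitive, `𝓛 = log D ≥ 3`, `j` arbitrary, and the four clauses of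
Lemmas 10.1–10.2 on the first range as hypotheses with constants `C₁, C₂ ≥ 0`, `c > 0` — (10.2)
`|𝔳₁ⱼ(y)| ≤ C₁T^{−c}` (`1 ≤ y ≤ P^{1/2}/T`), (10.5) `|𝔳₁ⱼ(y)| ≤ C₁𝓛⁻⁷` (`P^{1/2}/T < y ≤ P^{1/2}`), (10.8)
RELATIVE `|𝔳₂ⱼ(d,r) − L′Π(d,r)β_{j+1}β_{j+2}log P/500| ≤ C₂𝓛⁻¹⁵(∏_{q∣dr}(1−q⁻¹)⁻¹)²` (`dr ≤ P^{1/2}/T`) and the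
window rate `|𝔳₂ⱼ(d,r)| ≤ C₂𝓛^{−18/5}(∏_{q∣dr}(1−q⁻¹)⁻¹)²` (`P^{1/2}/T < dr ≤ P^{1/2}`) — one has
`‖Sj23Range(0, P^{1/2})‖ ≤ K_t·𝓛⁻¹⁰ + K_w/(𝓛⁹𝓛^{1/2})` with `K_t` as in sz-d56's `range1_bound_at` and
`K_w = 8e³²⁰C₁C₂` (weight `∏(1+106/q)` on both regions: `∏(1+25/q)·(∏(1−q⁻¹)⁻¹)² ≤ ∏(1+106/q)`).
[cite: Zhang2022LandauSiegel, §18 p.100; §10 (10.2), (10.5), (10.8), (10.11)] -/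
theorem range1_bound_at_rel (hL : 3 ≤ ell D) (hprim : χ.IsPrimitive) (j : ℕ) {c C₁ C₂ : ℝ}
    (hc : 0 < c) (hC₁ : 0 ≤ C₁) (hC₂ : 0 ≤ C₂)
    (hv1t : ∀ y : ℝ, 1 ≤ y → y ≤ bigP D ^ (0.5 : ℝ) / bigT D → ‖frakv1 c' χ j y‖ ≤ C₁ * bigT D ^ (-c))
    (hv1w : ∀ y : ℝ, bigP D ^ (0.5 : ℝ) / bigT D < y → y ≤ bigP D ^ (0.5 : ℝ) →
      ‖frakv1 c' χ j y‖ ≤ C₁ * (ell D ^ 7)⁻¹)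
    (hv2t : ∀ d r : ℕ, 1 ≤ d → 1 ≤ r → ((d * r : ℕ) : ℝ) ≤ bigP D ^ (0.5 : ℝ) / bigT D →
      ‖frakv2 c' χ j d r - deriv χ.LFunction 1 * PiW χ d r / 500 *
          (betaJ c' D (j + 1) * betaJ c' D (j + 2)) * Real.log (bigP D)‖ ≤
        C₂ * (ell D ^ 15)⁻¹ * (∏ q ∈ (d * r).primeFactors, (1 - (q : ℝ)⁻¹)⁻¹) ^ 2)
    (hv2w : ∀ d r : ℕ, 1 ≤ d → 1 ≤ r → bigP D ^ (0.5 : ℝ) / bigT D < ((d * r : ℕ) : ℝ) →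
      ((d * r : ℕ) : ℝ) ≤ bigP D ^ (0.5 : ℝ) →
        ‖frakv2 c' χ j d r‖ ≤
          C₂ * (ell D ^ (18 / 5 : ℝ))⁻¹ * (∏ q ∈ (d * r).primeFactors, (1 - (q : ℝ)⁻¹)⁻¹) ^ 2) :
    ‖Sj23Range c' χ j 0 (bigP D ^ (0.5 : ℝ))‖ ≤
      C₁ * (4 * Real.exp (9 / 2) * (3 * π * (1 + 5 * |c'|)) ^ 2 / 500 + C₂) *
          (1 + 6 * Real.exp 320) * (((9 + 10).factorial : ℝ) / c ^ (9 + 10)) / ell D ^ 10 +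
        8 * Real.exp 320 * C₁ * C₂ / (ell D ^ 9 * ell D ^ (1 / 2 : ℝ)) := by
  -- sizes
  have hL2 : 2 ≤ ell D := by linarith
  have hL1 : 1 ≤ ell D := by linarith
  have hℓ : 0 < ell D := by linarith
  have hlogD : 2 ≤ Real.log D := hL2
  have hP : 0 < bigP D := Real.exp_pos _
  have hPa : 0 < bigP D ^ (0.5 : ℝ) := Real.rpow_pos_of_pos hP _
  have hT : 0 < bigT D := Real.exp_pos _
  have hT1 : 1 ≤ bigT D := Real.one_le_exp (by rw [ell] at hℓ; positivity)
  have hTc : 0 < bigT D ^ (-c) := Real.rpow_pos_of_pos hT _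
  have h185 : 0 < ell D ^ (18 / 5 : ℝ) := Real.rpow_pos_of_pos hℓ _
  have hs0 : 0 < ell D ^ (1 / 2 : ℝ) := Real.rpow_pos_of_pos hℓ _
  set b0 : ℝ := 3 * π * (1 + 5 * |c'|) with hb0
  have hb00 : 0 ≤ b0 := by positivity
  set G : ℝ := 4 * Real.exp (9 / 2) * b0 ^ 2 / 500 with hG
  have hG0 : 0 ≤ G := by positivity
  -- `|β_k| ≤ b0/𝓛⁹`, `|L′| ≤ 4e^{9/2}𝓛²`, `log P = 𝓛⁹`
  have hβ : ∀ k, ‖betaJ c' D k‖ ≤ b0 / ell D ^ 9 := fun k => Sec18SjNorm.norm_betaJ_le_div c' hL2 k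
  have hLd : ‖deriv χ.LFunction 1‖ ≤ 4 * Real.exp (9 / 2) * ell D ^ 2 := by
    have hL' : 3 ≤ Real.log D := hL
    have hd := Lemma31.norm_deriv_LFunction_le_near_one χ hL' hprim (w := 1) (by simp; positivity)
    refine hd.trans ?_
    change 2 * Real.exp (9 / 2) * (1 + ell D) * ell D ≤ 4 * Real.exp (9 / 2) * ell D ^ 2
    have h0 : 0 ≤ Real.exp (9 / 2) := (Real.exp_pos _).le
    nlinarith [mul_nonneg h0 hℓ.le]
  -- the majorant of the piece (K1)
  have hmaj := Sec18SjNorm.norm_Sj23Range_le_majorant c' χ hlogD j 0 (bigP D ^ (0.5 : ℝ))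
  -- the two regions' weights
  set Z : ℕ := ⌊bigP D ^ (0.5 : ℝ)⌋₊ with hZ
  have hZ1 : 1 ≤ Z := by
    rw [hZ]; apply Nat.one_le_floor_iff _ |>.mpr
    exact Real.one_le_rpow (Real.one_le_exp (pow_nonneg hℓ.le 9)) (by norm_num)
  set h25 : ℕ → ℝ := fun n => ∏ q ∈ n.primeFactors, (1 + 25 / (q : ℝ)) with hh25
  set h106 : ℕ → ℝ := fun n => ∏ q ∈ n.primeFactors, (1 + 106 / (q : ℝ)) with hh106
  have h25_nonneg : ∀ n, 0 ≤ h25 n := fun n => prod_nonneg fun q _ => by positivity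
  -- the relative factor is dominated by `∏(1+2/q)²`
  have hRle : ∀ n : ℕ, (∏ q ∈ n.primeFactors, (1 - (q : ℝ)⁻¹)⁻¹) ^ 2 ≤
      ∏ q ∈ n.primeFactors, (1 + 2 / (q : ℝ)) ^ 2 := prod_one_sub_inv_inv_sq_le_prod2
  have hweight : ∀ d r : ℕ, 1 ≤ d → 1 ≤ r →
      h25 (d * r) / ((d : ℝ) * r * Nat.totient r) *
        (∏ q ∈ (d * r).primeFactors, (1 + 2 / (q : ℝ)) ^ 2) ≤
        h106 (d * r) / ((d : ℝ) * r * Nat.totient r) := by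
    intro d r hd1 hr1
    have hwpos : 0 < (d : ℝ) * r * Nat.totient r := by
      have : (0:ℝ) < d := by exact_mod_cast hd1
      have : (0:ℝ) < r := by exact_mod_cast hr1
      have : (0:ℝ) < Nat.totient r := by exact_mod_cast Nat.totient_pos.mpr hr1
      positivity
    rw [div_mul_eq_mul_div]
    exact div_le_div_of_nonneg_right (Sec18SjNorm.prod25_mul_prod2_sq_le (d * r)) hwpos.le
  -- pointwise bound of `𝔳₂` on the tiny range: `‖𝔳₂‖ ≤ (G + C₂)·∏(1+2/q)²`
  have hv2t' : ∀ d r : ℕ, 1 ≤ d → 1 ≤ r → ((d * r : ℕ) : ℝ) ≤ bigP D ^ (0.5 : ℝ) / bigT D →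
      ‖frakv2 c' χ j d r‖ ≤ (G + C₂) * ∏ q ∈ (d * r).primeFactors, (1 + 2 / (q : ℝ)) ^ 2 := by
    intro d r hd hr hdr
    have hPi := Sec18SjNorm.norm_PiW_le_prod χ (d := d) (r := r) (by omega) (by omega)
    set Pi2 : ℝ := ∏ q ∈ (d * r).primeFactors, (1 + 2 / (q : ℝ)) ^ 2 with hPi2
    have hPi2_one : 1 ≤ Pi2 := Finset.one_le_prod fun q _ => by
      have : 0 ≤ 2 / (q : ℝ) := by positivity
      nlinarith
    have hmain : ‖deriv χ.LFunction 1 * PiW χ d r / 500 *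
        (betaJ c' D (j + 1) * betaJ c' D (j + 2)) * Real.log (bigP D)‖ ≤ G * Pi2 := by
      rw [norm_mul, norm_mul, norm_div, norm_mul, norm_mul, Complex.norm_real, Real.norm_eq_abs,
        log_bigP, abs_of_pos (by positivity), RCLike.norm_ofNat]
      have s1 : ‖deriv χ.LFunction 1‖ * ‖PiW χ d r‖ ≤ (4 * Real.exp (9 / 2) * ell D ^ 2) * Pi2 :=
        mul_le_mul hLd hPi (norm_nonneg _) (by positivity)
      have s2 : ‖betaJ c' D (j + 1)‖ * ‖betaJ c' D (j + 2)‖ ≤ (b0 / ell D ^ 9) * (b0 / ell D ^ 9) :=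
        mul_le_mul (hβ _) (hβ _) (norm_nonneg _) (by positivity)
      calc ‖deriv χ.LFunction 1‖ * ‖PiW χ d r‖ / 500 *
            (‖betaJ c' D (j + 1)‖ * ‖betaJ c' D (j + 2)‖) * ell D ^ 9
          = (‖deriv χ.LFunction 1‖ * ‖PiW χ d r‖) *
              (‖betaJ c' D (j + 1)‖ * ‖betaJ c' D (j + 2)‖) * (ell D ^ 9 / 500) := by ring
        _ ≤ ((4 * Real.exp (9 / 2) * ell D ^ 2) * Pi2) * ((b0 / ell D ^ 9) * (b0 / ell D ^ 9)) *
              (ell D ^ 9 / 500) := by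
            apply mul_le_mul_of_nonneg_right _ (by positivity)
            exact mul_le_mul s1 s2 (by positivity) (by positivity)
        _ = G * Pi2 * (ell D ^ 2 / ell D ^ 9) := by rw [hG]; field_simp
        _ ≤ G * Pi2 * 1 := by
            gcongr
            rw [div_le_one (by positivity)]
            exact pow_le_pow_right₀ hL1 (by norm_num)
        _ = G * Pi2 := mul_one _
    have herr : C₂ * (ell D ^ 15)⁻¹ * (∏ q ∈ (d * r).primeFactors, (1 - (q : ℝ)⁻¹)⁻¹) ^ 2 ≤
        C₂ * Pi2 := by
      have h15 : (ell D ^ 15)⁻¹ ≤ 1 := inv_le_one_of_one_le₀ (one_le_pow₀ hL1)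
      calc C₂ * (ell D ^ 15)⁻¹ * (∏ q ∈ (d * r).primeFactors, (1 - (q : ℝ)⁻¹)⁻¹) ^ 2
          ≤ C₂ * 1 * Pi2 :=
            mul_le_mul (mul_le_mul_of_nonneg_left h15 hC₂) (hRle (d * r)) (sq_nonneg _)
              (by positivity)
        _ = C₂ * Pi2 := by ring
    calc ‖frakv2 c' χ j d r‖
        ≤ ‖frakv2 c' χ j d r - deriv χ.LFunction 1 * PiW χ d r / 500 *
              (betaJ c' D (j + 1) * betaJ c' D (j + 2)) * Real.log (bigP D)‖ +
            ‖deriv χ.LFunction 1 * PiW χ d r / 500 *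
              (betaJ c' D (j + 1) * betaJ c' D (j + 2)) * Real.log (bigP D)‖ :=
          norm_le_norm_sub_add _ _
      _ ≤ C₂ * Pi2 + G * Pi2 := add_le_add ((hv2t d r hd hr hdr).trans herr) hmain
      _ = (G + C₂) * Pi2 := by ring
  -- termwise splitting of the indicator `0 ≤ dr < P^{1/2}` into tiny + window
  have hterm : ∀ r ∈ Ico 1 (Nsupp D), ∀ d ∈ Ico 1 (Nsupp D),
      (if (0 : ℝ) ≤ ((d * r : ℕ) : ℝ) ∧ ((d * r : ℕ) : ℝ) < bigP D ^ (0.5 : ℝ) then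
          h25 (d * r) / ((d : ℝ) * r * Nat.totient r) *
            ‖frakv1 c' χ j ((d * r : ℕ) : ℝ)‖ * ‖frakv2 c' χ j d r‖ else 0) ≤
        (C₁ * bigT D ^ (-c) * (G + C₂)) *
          (if d * r ≤ Z then h106 (d * r) / ((d : ℝ) * r * Nat.totient r) else 0) +
        (C₁ * (ell D ^ 7)⁻¹ * (C₂ * (ell D ^ (18 / 5 : ℝ))⁻¹)) *
          (if bigP D ^ (1 / 2 : ℝ) / bigT D < ((d * r : ℕ) : ℝ) ∧ ((d * r : ℕ) : ℝ) ≤ bigP D ^ (1 / 2 : ℝ)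
            then h106 (d * r) / ((d : ℝ) * r * Nat.totient r) else 0) := by
    intro r hr d hd
    have hr1 : 1 ≤ r := (mem_Ico.mp hr).1
    have hd1 : 1 ≤ d := (mem_Ico.mp hd).1
    have hdr1 : (1 : ℝ) ≤ ((d * r : ℕ) : ℝ) := by exact_mod_cast Nat.mul_pos hd1 hr1
    have hwpos : 0 < (d : ℝ) * r * Nat.totient r := by
      have : (0:ℝ) < d := by exact_mod_cast hd1
      have : (0:ℝ) < r := by exact_mod_cast hr1
      have : (0:ℝ) < Nat.totient r := by exact_mod_cast Nat.totient_pos.mpr hr1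
      positivity
    have hw0 : 0 ≤ h25 (d * r) / ((d : ℝ) * r * Nat.totient r) := div_nonneg (h25_nonneg _) hwpos.le
    have hw106 : 0 ≤ h106 (d * r) / ((d : ℝ) * r * Nat.totient r) :=
      div_nonneg (prod_nonneg fun q _ => by positivity) hwpos.le
    have hhalf : bigP D ^ (1 / 2 : ℝ) = bigP D ^ (0.5 : ℝ) := by norm_num
    have hA0 : 0 ≤ C₁ * bigT D ^ (-c) * (G + C₂) := by positivity
    have hB0 : 0 ≤ C₁ * (ell D ^ 7)⁻¹ * (C₂ * (ell D ^ (18 / 5 : ℝ))⁻¹) := by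
      have : 0 ≤ (ell D ^ (18 / 5 : ℝ))⁻¹ := inv_nonneg.mpr h185.le
      positivity
    by_cases hcond : (0 : ℝ) ≤ ((d * r : ℕ) : ℝ) ∧ ((d * r : ℕ) : ℝ) < bigP D ^ (0.5 : ℝ)
    · rw [if_pos hcond]
      have hdrZ : d * r ≤ Z := by rw [hZ]; exact Nat.le_floor hcond.2.le
      rw [if_pos hdrZ]
      by_cases htiny : ((d * r : ℕ) : ℝ) ≤ bigP D ^ (0.5 : ℝ) / bigT D
      · -- tiny range
        have e1 := hv1t _ hdr1 htiny
        have e2 := hv2t' d r hd1 hr1 htiny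
        calc h25 (d * r) / ((d : ℝ) * r * Nat.totient r) *
              ‖frakv1 c' χ j ((d * r : ℕ) : ℝ)‖ * ‖frakv2 c' χ j d r‖
            ≤ h25 (d * r) / ((d : ℝ) * r * Nat.totient r) * (C₁ * bigT D ^ (-c)) *
                ((G + C₂) * ∏ q ∈ (d * r).primeFactors, (1 + 2 / (q : ℝ)) ^ 2) :=
              mul_le_mul (mul_le_mul_of_nonneg_left e1 hw0) e2 (norm_nonneg _)
                (mul_nonneg hw0 (by positivity))
          _ = (C₁ * bigT D ^ (-c) * (G + C₂)) * (h25 (d * r) / ((d : ℝ) * r * Nat.totient r) *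
                (∏ q ∈ (d * r).primeFactors, (1 + 2 / (q : ℝ)) ^ 2)) := by ring
          _ ≤ (C₁ * bigT D ^ (-c) * (G + C₂)) * (h106 (d * r) / ((d : ℝ) * r * Nat.totient r)) :=
              mul_le_mul_of_nonneg_left (hweight d r hd1 hr1) hA0
          _ ≤ _ := by
              have : 0 ≤ (C₁ * (ell D ^ 7)⁻¹ * (C₂ * (ell D ^ (18 / 5 : ℝ))⁻¹)) *
                  (if bigP D ^ (1 / 2 : ℝ) / bigT D < ((d * r : ℕ) : ℝ) ∧
                      ((d * r : ℕ) : ℝ) ≤ bigP D ^ (1 / 2 : ℝ)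
                    then h106 (d * r) / ((d : ℝ) * r * Nat.totient r) else 0) :=
                mul_nonneg hB0 (by split_ifs <;> [exact hw106; exact le_rfl])
              linarith
      · -- window
        push Not at htiny
        have hwin : bigP D ^ (1 / 2 : ℝ) / bigT D < ((d * r : ℕ) : ℝ) ∧
            ((d * r : ℕ) : ℝ) ≤ bigP D ^ (1 / 2 : ℝ) := by
          rw [hhalf]; exact ⟨htiny, hcond.2.le⟩
        rw [if_pos hwin]
        have e1 := hv1w _ htiny hcond.2.le
        have e2 := hv2w d r hd1 hr1 htiny hcond.2.le
        have e2' : ‖frakv2 c' χ j d r‖ ≤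
            C₂ * (ell D ^ (18 / 5 : ℝ))⁻¹ * ∏ q ∈ (d * r).primeFactors, (1 + 2 / (q : ℝ)) ^ 2 :=
          e2.trans (mul_le_mul_of_nonneg_left (hRle (d * r))
            (mul_nonneg hC₂ (inv_nonneg.mpr h185.le)))
        calc h25 (d * r) / ((d : ℝ) * r * Nat.totient r) *
              ‖frakv1 c' χ j ((d * r : ℕ) : ℝ)‖ * ‖frakv2 c' χ j d r‖
            ≤ h25 (d * r) / ((d : ℝ) * r * Nat.totient r) * (C₁ * (ell D ^ 7)⁻¹) *
                (C₂ * (ell D ^ (18 / 5 : ℝ))⁻¹ * ∏ q ∈ (d * r).primeFactors, (1 + 2 / (q : ℝ)) ^ 2) :=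
              mul_le_mul (mul_le_mul_of_nonneg_left e1 hw0) e2' (norm_nonneg _)
                (mul_nonneg hw0 (by positivity))
          _ = (C₁ * (ell D ^ 7)⁻¹ * (C₂ * (ell D ^ (18 / 5 : ℝ))⁻¹)) *
                (h25 (d * r) / ((d : ℝ) * r * Nat.totient r) *
                  ∏ q ∈ (d * r).primeFactors, (1 + 2 / (q : ℝ)) ^ 2) := by ring
          _ ≤ (C₁ * (ell D ^ 7)⁻¹ * (C₂ * (ell D ^ (18 / 5 : ℝ))⁻¹)) *
                (h106 (d * r) / ((d : ℝ) * r * Nat.totient r)) :=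
              mul_le_mul_of_nonneg_left (hweight d r hd1 hr1) hB0
          _ ≤ _ := by
              have : 0 ≤ (C₁ * bigT D ^ (-c) * (G + C₂)) *
                  (h106 (d * r) / ((d : ℝ) * r * Nat.totient r)) := mul_nonneg hA0 hw106
              linarith
    · rw [if_neg hcond]
      positivity
  -- sum the two majorants
  have hsumT := Sec18SjNorm.full_mass_le (c := 106) (by norm_num) hZ1 (Nsupp D)
  have hsumW := Sec18SjNorm.window_mass_le (c := 106) (by norm_num) (a := 1 / 2) (by norm_num) hL2
    (Nsupp D)
  have hS : ‖Sj23Range c' χ j 0 (bigP D ^ (0.5 : ℝ))‖ ≤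
      (C₁ * bigT D ^ (-c) * (G + C₂)) * (1 + 2 * Real.exp (3 * 106 + 2) * (2 + Real.log Z)) +
      (C₁ * (ell D ^ 7)⁻¹ * (C₂ * (ell D ^ (18 / 5 : ℝ))⁻¹)) *
        (2 * Real.exp (3 * 106 + 2) * (3 + ell D ^ (1.1 : ℝ))) := by
    refine hmaj.trans ?_
    refine (sum_le_sum fun r hr => sum_le_sum fun d hd => hterm r hr d hd).trans ?_
    have hA0 : 0 ≤ C₁ * bigT D ^ (-c) * (G + C₂) := by positivity
    have hB0 : 0 ≤ C₁ * (ell D ^ 7)⁻¹ * (C₂ * (ell D ^ (18 / 5 : ℝ))⁻¹) := by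
      have : 0 ≤ (ell D ^ (18 / 5 : ℝ))⁻¹ := inv_nonneg.mpr h185.le
      positivity
    simp only [sum_add_distrib, ← mul_sum]
    exact add_le_add (mul_le_mul_of_nonneg_left hsumT hA0) (mul_le_mul_of_nonneg_left hsumW hB0)
  -- `log Z ≤ 𝓛⁹/2`
  have hlogZ : Real.log Z ≤ ell D ^ 9 / 2 := by
    have hZle : (Z : ℝ) ≤ bigP D ^ (0.5 : ℝ) := Nat.floor_le hPa.le
    have hZpos : (0 : ℝ) < Z := by exact_mod_cast hZ1
    calc Real.log Z ≤ Real.log (bigP D ^ (0.5 : ℝ)) := Real.log_le_log hZpos hZle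
      _ = 0.5 * ell D ^ 9 := by rw [Real.log_rpow hP, log_bigP]
      _ = ell D ^ 9 / 2 := by ring
  -- tiny total ≤ K_t / 𝓛¹⁰
  have h9 : 1 ≤ ell D ^ 9 := one_le_pow₀ hL1
  have htiny : (C₁ * bigT D ^ (-c) * (G + C₂)) * (1 + 2 * Real.exp (3 * 106 + 2) * (2 + Real.log Z)) ≤
      C₁ * (G + C₂) * (1 + 6 * Real.exp 320) * (((9 + 10).factorial : ℝ) / c ^ (9 + 10)) /
        ell D ^ 10 := by
    have hmass : 1 + 2 * Real.exp (3 * 106 + 2) * (2 + Real.log Z) ≤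
        (1 + 6 * Real.exp 320) * ell D ^ 9 := by
      have e : (3 : ℝ) * 106 + 2 = 320 := by norm_num
      rw [e]
      have hexp := Real.exp_pos 320
      nlinarith
    have hTk := Sec18SjNorm.bigT_rpow_neg_mul_pow_le hc 9 hL1
    calc (C₁ * bigT D ^ (-c) * (G + C₂)) * (1 + 2 * Real.exp (3 * 106 + 2) * (2 + Real.log Z))
        ≤ (C₁ * bigT D ^ (-c) * (G + C₂)) * ((1 + 6 * Real.exp 320) * ell D ^ 9) :=
          mul_le_mul_of_nonneg_left hmass (by positivity)
      _ = C₁ * (G + C₂) * (1 + 6 * Real.exp 320) * (bigT D ^ (-c) * ell D ^ 9) := by ring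
      _ ≤ C₁ * (G + C₂) * (1 + 6 * Real.exp 320) *
          (((9 + 10).factorial : ℝ) / c ^ (9 + 10) / ell D ^ 10) :=
          mul_le_mul_of_nonneg_left hTk (by positivity)
      _ = _ := by ring
  -- window total ≤ K_w/(𝓛⁹𝓛^{1/2})
  have hwin : (C₁ * (ell D ^ 7)⁻¹ * (C₂ * (ell D ^ (18 / 5 : ℝ))⁻¹)) *
        (2 * Real.exp (3 * 106 + 2) * (3 + ell D ^ (1.1 : ℝ))) ≤
      8 * Real.exp 320 * C₁ * C₂ / (ell D ^ 9 * ell D ^ (1 / 2 : ℝ)) := by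
    have e : (3 : ℝ) * 106 + 2 = 320 := by norm_num
    rw [e]
    have hu1 : 1 ≤ ell D ^ (1.1 : ℝ) := Real.one_le_rpow hL1 (by norm_num)
    have h3 : 3 + ell D ^ (1.1 : ℝ) ≤ 4 * ell D ^ (1.1 : ℝ) := by linarith
    have hK : 0 ≤ C₁ * (ell D ^ 7)⁻¹ * (C₂ * (ell D ^ (18 / 5 : ℝ))⁻¹) * (2 * Real.exp 320) := by
      have : 0 ≤ (ell D ^ (18 / 5 : ℝ))⁻¹ := inv_nonneg.mpr h185.le
      positivity
    have hrate := window_rate_eq hℓ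
    calc C₁ * (ell D ^ 7)⁻¹ * (C₂ * (ell D ^ (18 / 5 : ℝ))⁻¹) *
          (2 * Real.exp 320 * (3 + ell D ^ (1.1 : ℝ)))
        = C₁ * (ell D ^ 7)⁻¹ * (C₂ * (ell D ^ (18 / 5 : ℝ))⁻¹) * (2 * Real.exp 320) *
            (3 + ell D ^ (1.1 : ℝ)) := by ring
      _ ≤ C₁ * (ell D ^ 7)⁻¹ * (C₂ * (ell D ^ (18 / 5 : ℝ))⁻¹) * (2 * Real.exp 320) *
            (4 * ell D ^ (1.1 : ℝ)) := mul_le_mul_of_nonneg_left h3 hK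
      _ = 8 * Real.exp 320 * C₁ * C₂ * (ell D ^ (1.1 : ℝ) / (ell D ^ 7 * ell D ^ (18 / 5 : ℝ))) := by
          field_simp
          ring
      _ = 8 * Real.exp 320 * C₁ * C₂ / (ell D ^ 9 * ell D ^ (1 / 2 : ℝ)) := by
          rw [hrate]; ring
  linarith [hS, htiny, hwin]

/-- **`Z22:§18.u009`-prose, "the sum over `dr < P^{0.5}` contributes `o(α)`", from Lemma 10.1 and the
RELATIVE Lemma 10.2** (`TypedSection18.Step18_range1`): assembly of `range1_bound_at_rel` with
`α = π𝓛⁻⁹` — the bound `K_t𝓛⁻¹⁰ + K_w𝓛⁻⁹𝓛^{−1/2}` is `≤ επ𝓛⁻⁹` once `𝓛 ≥ 2K_t/(επ)` and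
`𝓛^{1/2} ≥ 2K_w/(επ)`. The Lemma-10.2 inputs are the inline clause bundles: (10.8) relative (first clause
of `Skeleton.Lemma102Rel`, with its two companions carried unused) and the window rate
`C𝓛^{−18/5}(∏_{q∣dr}(1−q⁻¹)⁻¹)²`. [cite: Zhang2022LandauSiegel, §18 p.100] -/
theorem step18_range1_of_rel (h101 : Skeleton.Lemma101 c')
    (hmain : ∃ C : ℝ, ForAllLarge fun D _ χ => AssumptionA D χ →
      ∀ j ∈ ({1, 2, 3} : Finset ℕ), ∀ d r : ℕ, 1 ≤ d → 1 ≤ r →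
        (((d * r : ℕ) : ℝ) ≤ bigP D ^ (0.5 : ℝ) / bigT D →
          ‖frakv2 c' χ j d r - deriv χ.LFunction 1 * PiW χ d r / 500 *
            (betaJ c' D (j + 1) * betaJ c' D (j + 2)) * Real.log (bigP D)‖ ≤
              C * (ell D ^ 15)⁻¹ * (∏ q ∈ (d * r).primeFactors, (1 - (q : ℝ)⁻¹)⁻¹) ^ 2) ∧
        (bigP D ^ (0.5 : ℝ) < ((d * r : ℕ) : ℝ) → ((d * r : ℕ) : ℝ) ≤ bigP D ^ (0.502 : ℝ) / bigT D →
          ‖frakv2 c' χ j d r - 500 * deriv χ.LFunction 1 * PiW χ d r / Real.log (bigP D) *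
            (-1 + fraky1 c' D j ((d * r : ℕ) : ℝ))‖ ≤
              C * (ell D ^ 15)⁻¹ * (∏ q ∈ (d * r).primeFactors, (1 - (q : ℝ)⁻¹)⁻¹) ^ 2) ∧
        (bigP D ^ (0.502 : ℝ) < ((d * r : ℕ) : ℝ) →
          ((d * r : ℕ) : ℝ) ≤ bigP D ^ (0.504 : ℝ) / bigT D →
          ‖frakv2 c' χ j d r - 500 * deriv χ.LFunction 1 * PiW χ d r / Real.log (bigP D) *
            (1 + fraky2 c' D j ((d * r : ℕ) : ℝ))‖ ≤
              C * (ell D ^ 15)⁻¹ * (∏ q ∈ (d * r).primeFactors, (1 - (q : ℝ)⁻¹)⁻¹) ^ 2))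
    (hwin : ∃ C : ℝ, ForAllLarge fun D _ χ => AssumptionA D χ →
      ∀ j ∈ ({1, 2, 3} : Finset ℕ), ∀ d r : ℕ, 1 ≤ d → 1 ≤ r →
        ((bigP D ^ (0.5 : ℝ) / bigT D < ((d * r : ℕ) : ℝ) ∧ ((d * r : ℕ) : ℝ) ≤ bigP D ^ (0.5 : ℝ)) ∨
            (bigP D ^ (0.502 : ℝ) / bigT D < ((d * r : ℕ) : ℝ) ∧
              ((d * r : ℕ) : ℝ) ≤ bigP D ^ (0.502 : ℝ)) ∨
            (bigP D ^ (0.504 : ℝ) / bigT D < ((d * r : ℕ) : ℝ) ∧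
              ((d * r : ℕ) : ℝ) < bigP D ^ (0.504 : ℝ)) →
          ‖frakv2 c' χ j d r‖ ≤
            C * (ell D ^ (18 / 5 : ℝ))⁻¹ * (∏ q ∈ (d * r).primeFactors, (1 - (q : ℝ)⁻¹)⁻¹) ^ 2)) :
    Step18_range1 c' := by
  intro ε hε
  obtain ⟨c, hc, C₁, D₁, h1⟩ := h101
  obtain ⟨C₂, D₂, h2⟩ := hmain
  obtain ⟨C₃, D₃, h3⟩ := hwin
  -- nonnegative versions of the constants
  set A₁ : ℝ := |C₁| with hA₁
  set A₂ : ℝ := max |C₂| |C₃| with hA₂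
  have hA₂0 : 0 ≤ A₂ := le_trans (abs_nonneg _) (le_max_left _ _)
  have hC₂A : C₂ ≤ A₂ := le_trans (le_abs_self _) (le_max_left _ _)
  have hC₃A : C₃ ≤ A₂ := le_trans (le_abs_self _) (le_max_right _ _)
  set G : ℝ := 4 * Real.exp (9 / 2) * (3 * π * (1 + 5 * |c'|)) ^ 2 / 500 with hG
  set Kt : ℝ := A₁ * (G + A₂) * (1 + 6 * Real.exp 320) * (((9 + 10).factorial : ℝ) / c ^ (9 + 10))
    with hKt
  set Kw : ℝ := 8 * Real.exp 320 * A₁ * A₂ with hKw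
  have hKt0 : 0 ≤ Kt := by positivity
  have hKw0 : 0 ≤ Kw := by positivity
  obtain ⟨D₉, hD₉⟩ := exists_ell_ge' (max 3 (max (2 * Kt / (ε * π)) ((2 * Kw / (ε * π)) ^ 2)))
  refine ⟨max (max (max D₁ D₂) D₃) D₉, fun D _ χ hD hq hp hA j hj => ?_⟩
  have hD1 : D₁ ≤ D :=
    le_trans (le_trans (le_trans (le_max_left _ _) (le_max_left _ _)) (le_max_left _ _)) hD
  have hD2 : D₂ ≤ D :=
    le_trans (le_trans (le_trans (le_max_right _ _) (le_max_left _ _)) (le_max_left _ _)) hD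
  have hD3 : D₃ ≤ D := le_trans (le_trans (le_max_right _ _) (le_max_left _ _)) hD
  have hlog := hD₉ D (le_trans (le_max_right _ _) hD)
  have hL3 : 3 ≤ ell D := le_trans (le_max_left _ _) hlog
  have hKt' : 2 * Kt / (ε * π) ≤ ell D := le_trans (le_trans (le_max_left _ _) (le_max_right _ _)) hlog
  have hKw' : (2 * Kw / (ε * π)) ^ 2 ≤ ell D :=
    le_trans (le_trans (le_max_right _ _) (le_max_right _ _)) hlog
  have hℓ : 0 < ell D := by linarith
  have hL1 : 1 ≤ ell D := by linarith
  have hKw'' : 2 * Kw / (ε * π) ≤ ell D ^ (1 / 2 : ℝ) :=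
    le_rpow_half_of_sq_le (by positivity) hℓ.le hKw'
  have h185 : 0 < ell D ^ (18 / 5 : ℝ) := Real.rpow_pos_of_pos hℓ _
  have hs0 : 0 < ell D ^ (1 / 2 : ℝ) := Real.rpow_pos_of_pos hℓ _
  have h1D := h1 D χ hD1 hq hp hA j hj
  have h2D := h2 D χ hD2 hq hp hA j hj
  have h3D := h3 D χ hD3 hq hp hA j hj
  -- the four clauses, with `A₁, A₂`
  have hTc : 0 < bigT D ^ (-c) := Real.rpow_pos_of_pos (Real.exp_pos _) _
  have hv1t : ∀ y : ℝ, 1 ≤ y → y ≤ bigP D ^ (0.5 : ℝ) / bigT D →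
      ‖frakv1 c' χ j y‖ ≤ A₁ * bigT D ^ (-c) := fun y hy1 hy2 =>
    ((h1D y).1 hy1 hy2).trans (mul_le_mul_of_nonneg_right (le_abs_self _) hTc.le)
  have hv1w : ∀ y : ℝ, bigP D ^ (0.5 : ℝ) / bigT D < y → y ≤ bigP D ^ (0.5 : ℝ) →
      ‖frakv1 c' χ j y‖ ≤ A₁ * (ell D ^ 7)⁻¹ := fun y hy1 hy2 =>
    ((h1D y).2.2.2 (Or.inl ⟨hy1, hy2⟩)).trans (mul_le_mul_of_nonneg_right (le_abs_self _) (by positivity))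
  have hv2t : ∀ d r : ℕ, 1 ≤ d → 1 ≤ r → ((d * r : ℕ) : ℝ) ≤ bigP D ^ (0.5 : ℝ) / bigT D →
      ‖frakv2 c' χ j d r - deriv χ.LFunction 1 * PiW χ d r / 500 *
          (betaJ c' D (j + 1) * betaJ c' D (j + 2)) * Real.log (bigP D)‖ ≤
        A₂ * (ell D ^ 15)⁻¹ * (∏ q ∈ (d * r).primeFactors, (1 - (q : ℝ)⁻¹)⁻¹) ^ 2 :=
    fun d r hd hr hdr => ((h2D d r hd hr).1 hdr).trans
      (mul_le_mul_of_nonneg_right (mul_le_mul_of_nonneg_right hC₂A (by positivity)) (sq_nonneg _))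
  have hv2w : ∀ d r : ℕ, 1 ≤ d → 1 ≤ r → bigP D ^ (0.5 : ℝ) / bigT D < ((d * r : ℕ) : ℝ) →
      ((d * r : ℕ) : ℝ) ≤ bigP D ^ (0.5 : ℝ) →
        ‖frakv2 c' χ j d r‖ ≤
          A₂ * (ell D ^ (18 / 5 : ℝ))⁻¹ * (∏ q ∈ (d * r).primeFactors, (1 - (q : ℝ)⁻¹)⁻¹) ^ 2 :=
    fun d r hd hr h1' h2' => ((h3D d r hd hr) (Or.inl ⟨h1', h2'⟩)).trans
      (mul_le_mul_of_nonneg_right (mul_le_mul_of_nonneg_right hC₃A (inv_nonneg.mpr h185.le))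
        (sq_nonneg _))
  have hbound := range1_bound_at_rel c' χ hL3 hp j hc (abs_nonneg C₁) hA₂0 hv1t hv1w hv2t hv2w
  -- `α = π/𝓛⁹`; compare
  rw [alpha_eq']
  have hεπ : 0 < ε * π := by positivity
  have hfinal : Kt / ell D ^ 10 + Kw / (ell D ^ 9 * ell D ^ (1 / 2 : ℝ)) ≤ ε * (π / ell D ^ 9) := by
    have hKt2 : Kt / ell D ^ 10 ≤ ε * π / 2 / ell D ^ 9 := by
      rw [div_le_div_iff₀ (by positivity) (by positivity)]
      have : Kt ≤ ε * π / 2 * ell D := by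
        have := (div_le_iff₀ hεπ).mp hKt'
        linarith
      calc Kt * ell D ^ 9 ≤ (ε * π / 2 * ell D) * ell D ^ 9 := by gcongr
        _ = ε * π / 2 * ell D ^ 10 := by ring
    have hKw2 : Kw / (ell D ^ 9 * ell D ^ (1 / 2 : ℝ)) ≤ ε * π / 2 / ell D ^ 9 := by
      rw [div_le_div_iff₀ (by positivity) (by positivity)]
      have : Kw ≤ ε * π / 2 * ell D ^ (1 / 2 : ℝ) := by
        have := (div_le_iff₀ hεπ).mp hKw''
        linarith
      calc Kw * ell D ^ 9 ≤ (ε * π / 2 * ell D ^ (1 / 2 : ℝ)) * ell D ^ 9 := by gcongr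
        _ = ε * π / 2 * (ell D ^ 9 * ell D ^ (1 / 2 : ℝ)) := by ring
    have e : ε * (π / ell D ^ 9) = ε * π / 2 / ell D ^ 9 + ε * π / 2 / ell D ^ 9 := by ring
    rw [e]; exact add_le_add hKt2 hKw2
  have hKt_eq : |C₁| * (4 * Real.exp (9 / 2) * (3 * π * (1 + 5 * |c'|)) ^ 2 / 500 + A₂) *
      (1 + 6 * Real.exp 320) * (((9 + 10).factorial : ℝ) / c ^ (9 + 10)) / ell D ^ 10 +
      8 * Real.exp 320 * |C₁| * A₂ / (ell D ^ 9 * ell D ^ (1 / 2 : ℝ)) =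
      Kt / ell D ^ 10 + Kw / (ell D ^ 9 * ell D ^ (1 / 2 : ℝ)) := by
    rw [hKt, hKw, hG]
  exact (hbound.trans_eq hKt_eq).trans hfinal

end Range1Rel

/-! ### The cone over the RELATIVE Lemma 10.2: `Bound183` from `Eq183`, `Prop71`, `Lemma101` and the
relative clauses; the re-typed binders `Typed.Sec10Rel.Ded183RelW` and `Skeleton.Ded183Rel` HOLD -/

section ConeRel

/-- **`Skeleton.Bound183 c′` from (18.3), Proposition 7.1, Lemma 10.1 and the RELATIVE Lemma 10.2**
("Proof of (2.33)", Z22 p.100): the three range evaluations `Step18_range1 / Step18_u010 / Step18_u011b`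
come from `Lemma101` and the two relative Lemma-10.2 clause bundles (`step18_range1_of_rel`,
`step18_u010_of_rel`, `step18_u011b_of_rel`), u008/u009/u012 are outright tree theorems
(`step18_u008_holds`, `step18_u009_holds`, `step18_u012_holds`), whence u013
(`Section18SjEdges.step18_u013_of_ranges`), the two-sided size of `S_j(𝐚₂₃,𝐚₂₃)` (`sjNorm_of_ranges`),
`E(𝐚₂₃,𝐚₂₃) = o(𝔓)` (`Sec18Ded183.ecal23Negligible_of_sjNorm`), u014 (`Sec18Ded183.step18_u014_of_u013`) and
the bound (`Sec18Ded183.bound183_of_steps`). [cite: Zhang2022LandauSiegel, §18 p.100, (18.3), (2.33)] -/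
theorem bound183_of_rel (h183 : Skeleton.Eq183 c') (h71 : Skeleton.Prop71 c')
    (h101 : Skeleton.Lemma101 c')
    (hmain : ∃ C : ℝ, ForAllLarge fun D _ χ => AssumptionA D χ →
      ∀ j ∈ ({1, 2, 3} : Finset ℕ), ∀ d r : ℕ, 1 ≤ d → 1 ≤ r →
        (((d * r : ℕ) : ℝ) ≤ bigP D ^ (0.5 : ℝ) / bigT D →
          ‖frakv2 c' χ j d r - deriv χ.LFunction 1 * PiW χ d r / 500 *
            (betaJ c' D (j + 1) * betaJ c' D (j + 2)) * Real.log (bigP D)‖ ≤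
              C * (ell D ^ 15)⁻¹ * (∏ q ∈ (d * r).primeFactors, (1 - (q : ℝ)⁻¹)⁻¹) ^ 2) ∧
        (bigP D ^ (0.5 : ℝ) < ((d * r : ℕ) : ℝ) → ((d * r : ℕ) : ℝ) ≤ bigP D ^ (0.502 : ℝ) / bigT D →
          ‖frakv2 c' χ j d r - 500 * deriv χ.LFunction 1 * PiW χ d r / Real.log (bigP D) *
            (-1 + fraky1 c' D j ((d * r : ℕ) : ℝ))‖ ≤
              C * (ell D ^ 15)⁻¹ * (∏ q ∈ (d * r).primeFactors, (1 - (q : ℝ)⁻¹)⁻¹) ^ 2) ∧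
        (bigP D ^ (0.502 : ℝ) < ((d * r : ℕ) : ℝ) →
          ((d * r : ℕ) : ℝ) ≤ bigP D ^ (0.504 : ℝ) / bigT D →
          ‖frakv2 c' χ j d r - 500 * deriv χ.LFunction 1 * PiW χ d r / Real.log (bigP D) *
            (1 + fraky2 c' D j ((d * r : ℕ) : ℝ))‖ ≤
              C * (ell D ^ 15)⁻¹ * (∏ q ∈ (d * r).primeFactors, (1 - (q : ℝ)⁻¹)⁻¹) ^ 2))
    (hwin : ∃ C : ℝ, ForAllLarge fun D _ χ => AssumptionA D χ →
      ∀ j ∈ ({1, 2, 3} : Finset ℕ), ∀ d r : ℕ, 1 ≤ d → 1 ≤ r →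
        ((bigP D ^ (0.5 : ℝ) / bigT D < ((d * r : ℕ) : ℝ) ∧ ((d * r : ℕ) : ℝ) ≤ bigP D ^ (0.5 : ℝ)) ∨
            (bigP D ^ (0.502 : ℝ) / bigT D < ((d * r : ℕ) : ℝ) ∧
              ((d * r : ℕ) : ℝ) ≤ bigP D ^ (0.502 : ℝ)) ∨
            (bigP D ^ (0.504 : ℝ) / bigT D < ((d * r : ℕ) : ℝ) ∧
              ((d * r : ℕ) : ℝ) < bigP D ^ (0.504 : ℝ)) →
          ‖frakv2 c' χ j d r‖ ≤
            C * (ell D ^ (18 / 5 : ℝ))⁻¹ * (∏ q ∈ (d * r).primeFactors, (1 - (q : ℝ)⁻¹)⁻¹) ^ 2)) :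
    Skeleton.Bound183 c' :=
  Sec18Ded183.bound183_of_steps c' h183 h71
    (Sec18Ded183.step18_u014_of_u013 c'
      (step18_u013_of_ranges c' (step18_u008_holds c') (step18_u009_holds c')
        (step18_range1_of_rel c' h101 hmain hwin) (step18_u010_of_rel c' h101 hmain hwin)
        (step18_u011b_of_rel c' h101 hmain hwin) (step18_u012_holds c')))
    (Sec18Ded183.ecal23Negligible_of_sjNorm c'
      (sjNorm_of_ranges c' (step18_u008_holds c') (step18_u009_holds c')
        (step18_range1_of_rel c' h101 hmain hwin) (step18_u010_of_rel c' h101 hmain hwin)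
        (step18_u011b_of_rel c' h101 hmain hwin) (step18_u012_holds c')))

/-- A window bound of the shape `C𝓛⁻⁷·R` (any `R ≥ 0`) is of the shape `max(C,0)·𝓛^{−18/5}·R` once
`𝓛 ≥ 1` (`𝓛^{18/5} ≤ 𝓛⁷`). [folklore] -/
private theorem window_seven_le_rate {C L R t : ℝ} (hL : 1 ≤ L) (hR : 0 ≤ R) (ht : t ≤ C * (L ^ 7)⁻¹ * R) :
    t ≤ max C 0 * (L ^ (18 / 5 : ℝ))⁻¹ * R := by
  have hL0 : 0 < L := by linarith
  have h185 : 0 < L ^ (18 / 5 : ℝ) := Real.rpow_pos_of_pos hL0 _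
  have hle : L ^ (18 / 5 : ℝ) ≤ L ^ 7 := by
    calc L ^ (18 / 5 : ℝ) ≤ L ^ (7 : ℝ) := Real.rpow_le_rpow_of_exponent_le hL (by norm_num)
      _ = L ^ 7 := by norm_cast
  have hinv : (L ^ 7)⁻¹ ≤ (L ^ (18 / 5 : ℝ))⁻¹ := inv_anti₀ h185 hle
  refine ht.trans (mul_le_mul_of_nonneg_right ?_ hR)
  calc C * (L ^ 7)⁻¹ ≤ max C 0 * (L ^ 7)⁻¹ :=
        mul_le_mul_of_nonneg_right (le_max_left _ _) (by positivity)
    _ ≤ max C 0 * (L ^ (18 / 5 : ℝ))⁻¹ := mul_le_mul_of_nonneg_left hinv (le_max_right _ _)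

/-- **The re-typed §18 binder HOLDS: `Typed.Sec10Rel.Ded183RelW c′`** (`Eq183 → Prop71 → Lemma101 →
Lemma102RelW → Bound183`; RT-01′ of lane ZHANG-L, the §18 consumer of Lemma 10.2 re-pointed to the
reading `Typed.Sec10Rel.Lemma102RelW` = clauses (10.8)–(10.10) with error `C𝓛⁻¹⁵(∏_{q∣dr}(1−q⁻¹)⁻¹)²`
and the window clause `C𝓛⁻⁷(∏_{q∣dr}(1−q⁻¹)⁻¹)²`) — for EVERY `c′`: the first three clauses are the
`hmain` bundle of `bound183_of_rel` verbatim, and `C𝓛⁻⁷R ≤ max(C,0)𝓛^{−18/5}R` for `𝓛 ≥ 1` gives `hwin`.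
[cite: Zhang2022LandauSiegel, §18 pp.100–101, (18.3)] -/
theorem ded183RelW_holds : Typed.Sec10Rel.Ded183RelW c' := by
  intro h183 h71 h101 h102
  obtain ⟨C, D₀, h⟩ := h102
  obtain ⟨D₁, hD₁⟩ := exists_ell_ge' 1
  refine bound183_of_rel c' h183 h71 h101 ⟨C, D₀, fun D _ χ hD hq hp hA j hj d r hd hr => ?_⟩
    ⟨max C 0, max D₀ D₁, fun D _ χ hD hq hp hA j hj d r hd hr hw => ?_⟩
  · have h' := h D χ hD hq hp hA j hj d r hd hr
    exact ⟨h'.1, h'.2.1, h'.2.2.1⟩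
  · have h' := (h D χ (le_trans (le_max_left _ _) hD) hq hp hA j hj d r hd hr).2.2.2 hw
    exact window_seven_le_rate (hD₁ D (le_trans (le_max_right _ _) hD)) (sq_nonneg _) h'

/-- `Ded183RelW` — `_holds` alias of `ded183RelW_holds` above under the fact's exact name (appended
2026-08-28, D-0026 bookkeeping: the proof term is the existing theorem of this file; no statement,
definition or attribute is edited; no new named fact; the ledger's debt table listed the fact
unproved). [cite: Zhang2022LandauSiegel, §18 pp.100–101, (18.3)] -/
theorem _root_.Literature.NumberTheory.LFunctions.Zhang2022.Typed.Sec10Rel.Ded183RelW_holds :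
    Typed.Sec10Rel.Ded183RelW c' :=
  _root_.Literature.NumberTheory.LFunctions.Zhang2022.Typed.Section18.ded183RelW_holds (c' := c')

/-- **`Skeleton.Ded183Rel c′` HOLDS as well** (`Eq183 → Prop71 → Lemma101 → Lemma102Rel → Bound183`,
RT-01's first target; `Skeleton.Lemma102Rel` has the relative clauses (10.8)–(10.10) and the ABSOLUTE
window clause `‖𝔳₂ⱼ‖ ≤ C𝓛⁻⁷`, which implies the relative one since `(∏_{q∣dr}(1−q⁻¹)⁻¹)² ≥ 1`).
[cite: Zhang2022LandauSiegel, §18 pp.100–101, (18.3)] -/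
theorem ded183Rel_holds : Skeleton.Ded183Rel c' := by
  intro h183 h71 h101 h102
  obtain ⟨C, D₀, h⟩ := h102
  obtain ⟨D₁, hD₁⟩ := exists_ell_ge' 1
  refine bound183_of_rel c' h183 h71 h101 ⟨C, D₀, fun D _ χ hD hq hp hA j hj d r hd hr => ?_⟩
    ⟨max C 0, max D₀ D₁, fun D _ χ hD hq hp hA j hj d r hd hr hw => ?_⟩
  · have h' := h D χ hD hq hp hA j hj d r hd hr
    exact ⟨h'.1, h'.2.1, h'.2.2.1⟩
  · have h' := (h D χ (le_trans (le_max_left _ _) hD) hq hp hA j hj d r hd hr).2.2.2 hw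
    have hL1 : 1 ≤ ell D := hD₁ D (le_trans (le_max_right _ _) hD)
    have hdr0 : d * r ≠ 0 := mul_ne_zero (by omega) (by omega)
    have hR1 : 1 ≤ (∏ q ∈ (d * r).primeFactors, (1 - (q : ℝ)⁻¹)⁻¹) ^ 2 := by
      rw [prod_one_sub_inv_inv_sq_eq' hdr0]; exact one_le_ratio_sq hdr0
    have hL0 : 0 ≤ ell D := by linarith
    have h'' : ‖frakv2 c' χ j d r‖ ≤
        max C 0 * (ell D ^ 7)⁻¹ * (∏ q ∈ (d * r).primeFactors, (1 - (q : ℝ)⁻¹)⁻¹) ^ 2 := by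
      calc ‖frakv2 c' χ j d r‖ ≤ C * (ell D ^ 7)⁻¹ := h'
        _ ≤ max C 0 * (ell D ^ 7)⁻¹ := mul_le_mul_of_nonneg_right (le_max_left _ _) (by positivity)
        _ ≤ max C 0 * (ell D ^ 7)⁻¹ * (∏ q ∈ (d * r).primeFactors, (1 - (q : ℝ)⁻¹)⁻¹) ^ 2 :=
            le_mul_of_one_le_right (by positivity) hR1
    have := window_seven_le_rate hL1 (sq_nonneg _) h''
    rwa [max_eq_left (le_max_right C 0)] at this

/-- `Ded183Rel` — `_holds` alias of `ded183Rel_holds` above under the fact's exact name (appended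
2026-08-28, D-0026 bookkeeping: the proof term is the existing theorem of this file; no statement,
definition or attribute is edited; no new named fact; the ledger's debt table listed the fact
unproved). [cite: Zhang2022LandauSiegel, §18 pp.100–101, (18.3)] -/
theorem _root_.Literature.NumberTheory.LFunctions.Zhang2022.Skeleton.Ded183Rel_holds :
    Skeleton.Ded183Rel c' :=
  _root_.Literature.NumberTheory.LFunctions.Zhang2022.Typed.Section18.ded183Rel_holds (c' := c')

end ConeRel

/-! ### The clause-4 text OF RECORD (START-HERE R-26, the derivable form D3):
`‖𝔳₂ⱼ(d,r)‖ ≤ C·𝓛·(1 + log T)⁴/log P·(∏_{q∣dr}(1−q⁻¹)⁻¹)²` on the windows — the same cone -/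

section ConeRelD3

/-- The D3 window rate is of the shape `𝓛^{−18/5}`: for `L ≥ 1` and `R ≥ 0`,
`C·L·(1 + L^{1.1})⁴/L⁹·R ≤ 16·max(C,0)·L^{−18/5}·R` (`(1 + L^{1.1})⁴ ≤ 16L^{4.4}`, `1 + 4.4 + 3.6 = 9`). [folklore] -/
private theorem d3_rate_le {C L R t : ℝ} (hL : 1 ≤ L) (hR : 0 ≤ R)
    (ht : t ≤ C * L * (1 + L ^ (1.1 : ℝ)) ^ 4 / L ^ 9 * R) :
    t ≤ 16 * max C 0 * (L ^ (18 / 5 : ℝ))⁻¹ * R := by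
  have hL0 : 0 < L := by linarith
  have hu1 : 1 ≤ L ^ (1.1 : ℝ) := Real.one_le_rpow hL (by norm_num)
  have hu0 : 0 ≤ L ^ (1.1 : ℝ) := by linarith
  have h185 : 0 < L ^ (18 / 5 : ℝ) := Real.rpow_pos_of_pos hL0 _
  -- `L · (L^{1.1})⁴ · L^{18/5} = L⁹`
  have hsplit : L * (L ^ (1.1 : ℝ)) ^ 4 * L ^ (18 / 5 : ℝ) = L ^ 9 := by
    have e1 : (L ^ (1.1 : ℝ)) ^ 4 = L ^ ((1.1 : ℝ) * 4) := by
      rw [← Real.rpow_natCast (L ^ (1.1 : ℝ)) 4, ← Real.rpow_mul hL0.le]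
      norm_num
    have e2 : L = L ^ (1 : ℝ) := (Real.rpow_one L).symm
    rw [e1]
    conv_lhs => rw [e2]
    rw [← Real.rpow_mul hL0.le, ← Real.rpow_mul hL0.le, ← Real.rpow_add hL0, ← Real.rpow_add hL0,
      ← Real.rpow_natCast L 9]
    norm_num
  have h4 : (1 + L ^ (1.1 : ℝ)) ^ 4 ≤ 16 * (L ^ (1.1 : ℝ)) ^ 4 := by
    have : 1 + L ^ (1.1 : ℝ) ≤ 2 * L ^ (1.1 : ℝ) := by linarith
    calc (1 + L ^ (1.1 : ℝ)) ^ 4 ≤ (2 * L ^ (1.1 : ℝ)) ^ 4 := pow_le_pow_left₀ (by linarith) this 4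
      _ = 16 * (L ^ (1.1 : ℝ)) ^ 4 := by ring
  have key : L * (1 + L ^ (1.1 : ℝ)) ^ 4 / L ^ 9 ≤ 16 * (L ^ (18 / 5 : ℝ))⁻¹ := by
    rw [div_le_iff₀ (by positivity)]
    calc L * (1 + L ^ (1.1 : ℝ)) ^ 4 ≤ L * (16 * (L ^ (1.1 : ℝ)) ^ 4) :=
          mul_le_mul_of_nonneg_left h4 hL0.le
      _ = 16 * (L ^ (18 / 5 : ℝ))⁻¹ * (L * (L ^ (1.1 : ℝ)) ^ 4 * L ^ (18 / 5 : ℝ)) := by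
          field_simp
      _ = 16 * (L ^ (18 / 5 : ℝ))⁻¹ * L ^ 9 := by rw [hsplit]
  refine ht.trans ?_
  have hC : C * L * (1 + L ^ (1.1 : ℝ)) ^ 4 / L ^ 9 ≤ max C 0 * (L * (1 + L ^ (1.1 : ℝ)) ^ 4 / L ^ 9) := by
    have h0 : 0 ≤ L * (1 + L ^ (1.1 : ℝ)) ^ 4 / L ^ 9 := by positivity
    calc C * L * (1 + L ^ (1.1 : ℝ)) ^ 4 / L ^ 9 = C * (L * (1 + L ^ (1.1 : ℝ)) ^ 4 / L ^ 9) := by ring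
      _ ≤ max C 0 * (L * (1 + L ^ (1.1 : ℝ)) ^ 4 / L ^ 9) :=
          mul_le_mul_of_nonneg_right (le_max_left _ _) h0
  calc C * L * (1 + L ^ (1.1 : ℝ)) ^ 4 / L ^ 9 * R
      ≤ max C 0 * (L * (1 + L ^ (1.1 : ℝ)) ^ 4 / L ^ 9) * R := mul_le_mul_of_nonneg_right hC hR
    _ ≤ max C 0 * (16 * (L ^ (18 / 5 : ℝ))⁻¹) * R :=
        mul_le_mul_of_nonneg_right (mul_le_mul_of_nonneg_left key (le_max_right _ _)) hR
    _ = 16 * max C 0 * (L ^ (18 / 5 : ℝ))⁻¹ * R := by ring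

/-- **`Skeleton.Bound183 c′` from (18.3), Proposition 7.1, Lemma 10.1 and Lemma 10.2 in the reading OF
RECORD for RT-01′** (zl-lead START-HERE R-26, the derivable form «D3» of the window clause (10.11):
`‖𝔳₂ⱼ(d,r)‖ ≤ C·𝓛·(1 + log T)⁴/log P·(∏_{q∣dr}(1−q⁻¹)⁻¹)²`, i.e. `≈ C𝓛^{−3.6}(dr/φ(dr))²`; clauses (10.8)–(10.10)
relative as in `Skeleton.Lemma102Rel`). With `log T = 𝓛^{1.1}`, `log P = 𝓛⁹` and `(1 + 𝓛^{1.1})⁴ ≤ 16𝓛^{4.4}` the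
window rate is `≤ 16max(C,0)·𝓛^{−18/5}·(dr/φ(dr))²` (`𝓛 ≥ 1`), so `bound183_of_rel` applies (window budget
`𝓛^{1.1−7−3.6} = 𝓛^{−9.5} = o(α)`, margin `𝓛^{−1/2}` — zl-w10-ref-2's arithmetic, here kernel-checked). vs PRINT: clause
(10.11) WEAKER than print (loses uniformity and the rate `𝓛⁻⁷`); the §18 consumer is re-proved, (18.3)'s bound unchanged.
[cite: Zhang2022LandauSiegel, §18 p.100, (18.3), (2.33); §10 (10.11) p.55] -/
theorem bound183_of_relD3 (h183 : Skeleton.Eq183 c') (h71 : Skeleton.Prop71 c')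
    (h101 : Skeleton.Lemma101 c')
    (hmain : ∃ C : ℝ, ForAllLarge fun D _ χ => AssumptionA D χ →
      ∀ j ∈ ({1, 2, 3} : Finset ℕ), ∀ d r : ℕ, 1 ≤ d → 1 ≤ r →
        (((d * r : ℕ) : ℝ) ≤ bigP D ^ (0.5 : ℝ) / bigT D →
          ‖frakv2 c' χ j d r - deriv χ.LFunction 1 * PiW χ d r / 500 *
            (betaJ c' D (j + 1) * betaJ c' D (j + 2)) * Real.log (bigP D)‖ ≤
              C * (ell D ^ 15)⁻¹ * (∏ q ∈ (d * r).primeFactors, (1 - (q : ℝ)⁻¹)⁻¹) ^ 2) ∧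
        (bigP D ^ (0.5 : ℝ) < ((d * r : ℕ) : ℝ) → ((d * r : ℕ) : ℝ) ≤ bigP D ^ (0.502 : ℝ) / bigT D →
          ‖frakv2 c' χ j d r - 500 * deriv χ.LFunction 1 * PiW χ d r / Real.log (bigP D) *
            (-1 + fraky1 c' D j ((d * r : ℕ) : ℝ))‖ ≤
              C * (ell D ^ 15)⁻¹ * (∏ q ∈ (d * r).primeFactors, (1 - (q : ℝ)⁻¹)⁻¹) ^ 2) ∧
        (bigP D ^ (0.502 : ℝ) < ((d * r : ℕ) : ℝ) →
          ((d * r : ℕ) : ℝ) ≤ bigP D ^ (0.504 : ℝ) / bigT D →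
          ‖frakv2 c' χ j d r - 500 * deriv χ.LFunction 1 * PiW χ d r / Real.log (bigP D) *
            (1 + fraky2 c' D j ((d * r : ℕ) : ℝ))‖ ≤
              C * (ell D ^ 15)⁻¹ * (∏ q ∈ (d * r).primeFactors, (1 - (q : ℝ)⁻¹)⁻¹) ^ 2))
    (hwinD3 : ∃ C : ℝ, ForAllLarge fun D _ χ => AssumptionA D χ →
      ∀ j ∈ ({1, 2, 3} : Finset ℕ), ∀ d r : ℕ, 1 ≤ d → 1 ≤ r →
        ((bigP D ^ (0.5 : ℝ) / bigT D < ((d * r : ℕ) : ℝ) ∧ ((d * r : ℕ) : ℝ) ≤ bigP D ^ (0.5 : ℝ)) ∨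
            (bigP D ^ (0.502 : ℝ) / bigT D < ((d * r : ℕ) : ℝ) ∧
              ((d * r : ℕ) : ℝ) ≤ bigP D ^ (0.502 : ℝ)) ∨
            (bigP D ^ (0.504 : ℝ) / bigT D < ((d * r : ℕ) : ℝ) ∧
              ((d * r : ℕ) : ℝ) < bigP D ^ (0.504 : ℝ)) →
          ‖frakv2 c' χ j d r‖ ≤
            C * ell D * (1 + Real.log (bigT D)) ^ 4 / Real.log (bigP D) *
              (∏ q ∈ (d * r).primeFactors, (1 - (q : ℝ)⁻¹)⁻¹) ^ 2)) :
    Skeleton.Bound183 c' := by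
  obtain ⟨C, D₀, h⟩ := hwinD3
  obtain ⟨D₁, hD₁⟩ := exists_ell_ge' 1
  refine bound183_of_rel c' h183 h71 h101 hmain
    ⟨16 * max C 0, max D₀ D₁, fun D _ χ hD hq hp hA j hj d r hd hr hw => ?_⟩
  have h' := h D χ (le_trans (le_max_left _ _) hD) hq hp hA j hj d r hd hr hw
  have hL1 : 1 ≤ ell D := hD₁ D (le_trans (le_max_right _ _) hD)
  rw [log_bigT, log_bigP] at h'
  exact d3_rate_le hL1 (sq_nonneg _) h'


/-- **The RT-01′ binder of record HOLDS: `Skeleton.Ded183RelW c′`** (`Eq183 → Prop71 → Lemma101 →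
Skeleton.Lemma102RelW → Bound183`, zl-w10-typer's `SkeletonLemma102RelW`, clause 4 = the derivable tail-mean
form D3 of START-HERE R-26) — for EVERY `c′`, by `bound183_of_relD3` (clauses 1–3 and the D3 window clause of
`Skeleton.Lemma102RelW` are its two bundles verbatim). vs PRINT: the consumed Lemma 10.2 is WEAKER than print
(relative factor `(dr/φ(dr))²`, window rate `𝓛(1+log T)⁴/log P`); the §18 conclusion `Bound183` is unchanged.
[cite: Zhang2022LandauSiegel, §18 pp.100–101, (18.3)] -/
theorem _root_.Literature.NumberTheory.LFunctions.Zhang2022.Skeleton.ded183RelW_holds :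
    Skeleton.Ded183RelW c' := by
  intro h183 h71 h101 h102
  obtain ⟨C, D₀, h⟩ := h102
  refine bound183_of_relD3 c' h183 h71 h101 ⟨C, D₀, fun D _ χ hD hq hp hA j hj d r hd hr => ?_⟩
    ⟨C, D₀, fun D _ χ hD hq hp hA j hj d r hd hr hw => (h D χ hD hq hp hA j hj d r hd hr).2.2.2 hw⟩
  have h' := h D χ hD hq hp hA j hj d r hd hr
  exact ⟨h'.1, h'.2.1, h'.2.2.1⟩

/-- `Ded183RelW` — `_holds` alias of `ded183RelW_holds` above under the fact's exact name (appended
2026-08-28, D-0026 bookkeeping: the proof term is the existing theorem of this file; no statement,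
definition or attribute is edited; no new named fact; the ledger's debt table listed the fact
unproved). [cite: Zhang2022LandauSiegel, §18 pp.100–101, (18.3)] -/
theorem _root_.Literature.NumberTheory.LFunctions.Zhang2022.Skeleton.Ded183RelW_holds :
    Skeleton.Ded183RelW c' :=
  _root_.Literature.NumberTheory.LFunctions.Zhang2022.Skeleton.ded183RelW_holds (c' := c')

end ConeRelD3

end Literature.NumberTheory.LFunctions.Zhang2022.Typed.Section18
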